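import Literature.Analysis.FluidPDE.ConstantinSmallViscosityCalculus
import HarnessLib

/-!
# Constantin's small-viscosity comparison theorem, II: the slice inequality

Analysis/FluidPDE support file (theorems only, no definitions, no named facts), the second of
the files proving the named fact `Literature.Analysis.FluidPDE.constantin_small_viscosity`
(P. Constantin, Comm. Math. Phys. 104 (1986), Thm. 1.1). At a fixed time, for a smooth
divergence-free `a` (the Navier–Stokes slice `u(t)`), a smooth divergence-free `b` (the Euler
slice `v(t)`), pressures `p₁, p₂`, the difference `w = a − b` and a word `α` of length `n`, the
`∂^α`-derivative of the difference of the two momentum right-hand sides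
(`ν Δaᵢ − ∂ᵢp₁ − (a·∇)aᵢ` minus `0·Δbᵢ − ∂ᵢp₂ − (b·∇)bᵢ`, the shape of the tree's
`IsClassicalNSSolutionOn.timeDerivWithin_comp_eq`) is paired with `χ ∂^α wᵢ` for a smooth
compactly supported weight `0 ≤ χ ≤ 1` (later the cutoff `χ_R`), following Constantin 1986, §1,
(1.7)–(1.10) (the `H^m` energy method for `w`, Kato's estimates (1.8)–(1.9)):

* `constantin_ipderiv_rhs_sub_rhs_eq` — the pointwise decomposition into viscous term, transport
  of the top derivative, Leibniz commutators, the linear term `(w·∇)b` and the pressure;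
* `constantin_transport_pairing_eq`, `constantin_viscous_pairing_eq`,
  `constantin_pressure_pairing_eq` (+ `constantin_integral_ipderiv_pressureTest_eq_zero`,
  `constantin_abs_ipderiv_pressureTest_le`) — the integrations by parts: transport and pressure
  contribute only terms carrying a derivative of the weight (cutoff errors), the viscous term is
  dissipation (discarded) plus a cutoff error plus the forcing `νΔb`;
* `constantin_transport_term_le`, `constantin_viscous_term_le`, `constantin_linear_term_le`,
  `constantin_commutator_term_le`, `constantin_pressure_term_le` — the bounds of the five terms
  by level integrals `∫∑ᵢ|∇ᵏwᵢ|²`, sup bounds of `a` and of the derivatives of `b`, `‖Q‖₂` for the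
  pressure difference `p₁ − p₂ = Q + c₀`, and the **trilinear terms**
  `∫ χ|∇ᵏwⱼ||∇^{n-k+1}wᵢ||∂^α wᵢ|`, which are kept;
* `constantin_slice_word_pairing_le` — the slice inequality for a fixed word, (1.10) localised
  and before time integration.

Everything is stated on `ℝ^ι` for a finite index type `ι`; dimension three enters only in the
sequel (Sobolev imbedding). No measurability or decay hypotheses beyond integrability of the
level integrals are used: bounded terms are estimated with the drop-in Cauchy–Schwarz bounds of
the calculus file, which need no integrability of the integrand.

## Mathlib / tree search

Tree (used): `CoordDerivatives` (`ipderiv_*`, `dnorm_*`, `abs_ipderiv_mul_sub_mul_ipderiv_le`),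
`NSVorticityEnergy` (`integral_mul_pderiv_eq_neg`, `contDiff_comp_of_contDiff`),
`ConstantinSmallViscosityCalculus` (part I). `lean search 'rhs_sub_rhs|pressure_pairing|word_pairing'`:
none before this file; the tree's `NSVorticitySlice.transport_term_le` is the vorticity-equation
analogue for a single solution (hence the `constantin_` prefix throughout).

## References

* P. Constantin, *Note on loss of regularity for solutions of the 3-D incompressible Euler and
  related equations*, Comm. Math. Phys. 104 (1986), 311–326, §1, (1.7)–(1.10). [Constantin1986]
-/

noncomputable section

open MeasureTheory Set Function Filter
open scoped ENNReal NNReal ContDiff BigOperators Topology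

namespace Literature.Analysis.FluidPDE

section Pointwise

variable {ι : Type*} [Fintype ι] [DecidableEq ι]

/-- **The differentiated difference equation, pointwise.** For smooth fields `a, b` (later the
Navier–Stokes and the Euler velocity at a fixed time) and smooth `p₁, p₂` (the pressures), the
`∂^α`-derivative of the difference of the two right-hand sides
`ν Δaᵢ − ∂ᵢp₁ − (a·∇)aᵢ` and `0·Δbᵢ − ∂ᵢp₂ − (b·∇)bᵢ` (the shape of
`IsClassicalNSSolutionOn.timeDerivWithin_comp_eq`) decomposes, with `w = a − b`, `r = p₁ − p₂`,
`G = ∂^α wᵢ`, as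
`ν ∑ⱼ ∂ⱼ∂ⱼ ∂^α aᵢ − ∑ⱼ aⱼ ∂ⱼG − ∑ⱼ [∂^α(aⱼ∂ⱼwᵢ) − aⱼ ∂^α∂ⱼwᵢ] − ∑ⱼ ∂^α(wⱼ ∂ⱼbᵢ) − ∂ᵢ ∂^α r`
(transport of the top derivative by `a`, Leibniz commutators, the linear term, the pressure):
Constantin 1986, (1.7) differentiated `|α|` times, `(a·∇)a − (b·∇)b = (a·∇)w + (w·∇)b`. [cite: Constantin1986, §1 (1.7)] -/
theorem constantin_ipderiv_rhs_sub_rhs_eq {a b : EuclideanSpace ℝ ι → EuclideanSpace ℝ ι}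
    {p₁ p₂ : EuclideanSpace ℝ ι → ℝ} (ha : ContDiff ℝ ∞ a) (hb : ContDiff ℝ ∞ b)
    (hp₁ : ContDiff ℝ ∞ p₁) (hp₂ : ContDiff ℝ ∞ p₂) (ν : ℝ) {n : ℕ} (α : Fin n → ι) (i : ι)
    (x : EuclideanSpace ℝ ι) :
    ipderiv α (fun y => ν * ∑ j, pderiv j (pderiv j fun z => a z i) y - pderiv i p₁ y -
        ∑ j, a y j * pderiv j (fun z => a z i) y) x -
      ipderiv α (fun y => 0 * ∑ j, pderiv j (pderiv j fun z => b z i) y - pderiv i p₂ y -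
        ∑ j, b y j * pderiv j (fun z => b z i) y) x =
    ν * ∑ j, pderiv j (pderiv j (ipderiv α fun z => a z i)) x -
      ∑ j, a x j * pderiv j (ipderiv α fun z => a z i - b z i) x -
      ∑ j, (ipderiv α (fun y => a y j * pderiv j (fun z => a z i - b z i) y) x -
        a x j * ipderiv α (pderiv j fun z => a z i - b z i) x) -
      ∑ j, ipderiv α (fun y => (a y j - b y j) * pderiv j (fun z => b z i) y) x -
      pderiv i (ipderiv α fun z => p₁ z - p₂ z) x := by
  -- smoothness of all the players
  have hA : ∀ j, ContDiff ℝ ∞ fun y => a y j := fun j => contDiff_comp_of_contDiff ha j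
  have hB : ∀ j, ContDiff ℝ ∞ fun y => b y j := fun j => contDiff_comp_of_contDiff hb j
  have hW : ∀ j, ContDiff ℝ ∞ fun y => a y j - b y j := fun j => (hA j).sub (hB j)
  have hdA : ∀ j l, ContDiff ℝ ∞ (pderiv l fun y => a y j) := fun j l => contDiff_pderiv (hA j) l
  have hdB : ∀ j l, ContDiff ℝ ∞ (pderiv l fun y => b y j) := fun j l => contDiff_pderiv (hB j) l
  have hdW : ∀ j l, ContDiff ℝ ∞ (pderiv l fun y => a y j - b y j) := fun j l =>
    contDiff_pderiv (hW j) l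
  have hR : ContDiff ℝ ∞ fun y => p₁ y - p₂ y := hp₁.sub hp₂
  -- (1) rewrite the two right-hand sides as one smooth combination
  have hdiffA : ∀ j, Differentiable ℝ fun y => a y j := fun j => (hA j).differentiable (by simp)
  have hdiffB : ∀ j, Differentiable ℝ fun y => b y j := fun j => (hB j).differentiable (by simp)
  have hpw : ∀ j y, pderiv j (fun z => a z i - b z i) y = pderiv j (fun z => a z i) y -
      pderiv j (fun z => b z i) y := fun j y => by rw [pderiv_sub (hdiffA i) (hdiffB i)]
  have hpr : ∀ y, pderiv i (fun z => p₁ z - p₂ z) y = pderiv i p₁ y - pderiv i p₂ y := fun y => by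
    rw [pderiv_sub (hp₁.differentiable (by simp)) (hp₂.differentiable (by simp))]
  have hfun : (fun y => (ν * ∑ j, pderiv j (pderiv j fun z => a z i) y - pderiv i p₁ y -
        ∑ j, a y j * pderiv j (fun z => a z i) y) -
        (0 * ∑ j, pderiv j (pderiv j fun z => b z i) y - pderiv i p₂ y -
        ∑ j, b y j * pderiv j (fun z => b z i) y)) =
      fun y => ν * ∑ j, pderiv j (pderiv j fun z => a z i) y -
        ∑ j, a y j * pderiv j (fun z => a z i - b z i) y -
        ∑ j, (a y j - b y j) * pderiv j (fun z => b z i) y -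
        pderiv i (fun z => p₁ z - p₂ z) y := by
    funext y
    simp only [hpw, hpr, zero_mul, mul_sub, sub_mul, Finset.sum_sub_distrib]
    ring
  -- `∂^α` of the difference is `∂^α` of the combination
  have hF₁ : ContDiff ℝ ∞ fun y => ν * ∑ j, pderiv j (pderiv j fun z => a z i) y - pderiv i p₁ y -
      ∑ j, a y j * pderiv j (fun z => a z i) y :=
    ((contDiff_const.mul (ContDiff.sum fun j _ => contDiff_pderiv (hdA i j) j)).sub
      (contDiff_pderiv hp₁ i)).sub (ContDiff.sum fun j _ => (hA j).mul (hdA i j))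
  have hF₂ : ContDiff ℝ ∞ fun y => 0 * ∑ j, pderiv j (pderiv j fun z => b z i) y - pderiv i p₂ y -
      ∑ j, b y j * pderiv j (fun z => b z i) y :=
    ((contDiff_const.mul (ContDiff.sum fun j _ => contDiff_pderiv (hdB i j) j)).sub
      (contDiff_pderiv hp₂ i)).sub (ContDiff.sum fun j _ => (hB j).mul (hdB i j))
  have e0 := ipderiv_sub hF₁ hF₂ α
  simp only at e0
  rw [← congrFun e0 x, hfun]
  -- (2) distribute `∂^α`
  have hS₁ : ContDiff ℝ ∞ fun y => ν * ∑ j, pderiv j (pderiv j fun z => a z i) y :=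
    contDiff_const.mul (ContDiff.sum fun j _ => contDiff_pderiv (hdA i j) j)
  have hS₂ : ContDiff ℝ ∞ fun y => ∑ j, a y j * pderiv j (fun z => a z i - b z i) y :=
    ContDiff.sum fun j _ => (hA j).mul (hdW i j)
  have hS₃ : ContDiff ℝ ∞ fun y => ∑ j, (a y j - b y j) * pderiv j (fun z => b z i) y :=
    ContDiff.sum fun j _ => (hW j).mul (hdB i j)
  have hS₄ : ContDiff ℝ ∞ (pderiv i fun z => p₁ z - p₂ z) := contDiff_pderiv hR i
  have e1 := ipderiv_sub ((hS₁.sub hS₂).sub hS₃) hS₄ α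
  have e2 := ipderiv_sub (hS₁.sub hS₂) hS₃ α
  have e3 := ipderiv_sub hS₁ hS₂ α
  have e4 := ipderiv_const_mul (f := fun y => ∑ j, pderiv j (pderiv j fun z => a z i) y)
    (ContDiff.sum fun j _ => contDiff_pderiv (hdA i j) j) ν α
  have e5 := ipderiv_finset_sum Finset.univ (f := fun j y => pderiv j (pderiv j fun z => a z i) y)
    (fun j => contDiff_pderiv (hdA i j) j) α
  have e6 := ipderiv_finset_sum Finset.univ
    (f := fun j y => a y j * pderiv j (fun z => a z i - b z i) y) (fun j => (hA j).mul (hdW i j)) α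
  have e7 := ipderiv_finset_sum Finset.univ
    (f := fun j y => (a y j - b y j) * pderiv j (fun z => b z i) y) (fun j => (hW j).mul (hdB i j)) α
  simp only at e1 e2 e3 e4 e5 e6 e7
  rw [e1]
  simp only
  rw [e2]
  simp only
  rw [e3]
  simp only
  rw [e4, e6, e7]
  simp only
  rw [e5]
  simp only
  -- (3) commute `∂^α` with `∂ⱼ∂ⱼ`, `∂ⱼ` and `∂ᵢ`
  have e8 : ∀ j, ipderiv α (pderiv j (pderiv j fun z => a z i)) x =
      pderiv j (pderiv j (ipderiv α fun z => a z i)) x := fun j => by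
    rw [ipderiv_pderiv (hdA i j), ipderiv_pderiv (hA i)]
  have e9 : ipderiv α (pderiv i fun z => p₁ z - p₂ z) x = pderiv i (ipderiv α fun z => p₁ z - p₂ z) x := by
    rw [ipderiv_pderiv hR]
  have e10 : ∀ j, ipderiv α (pderiv j fun z => a z i - b z i) x =
      pderiv j (ipderiv α fun z => a z i - b z i) x := fun j => by
    rw [ipderiv_pderiv (hW i)]
  simp only [e8, e9]
  -- (4) insert the commutators
  have e11 : ∑ j, ipderiv α (fun y => a y j * pderiv j (fun z => a z i - b z i) y) x =
      ∑ j, a x j * pderiv j (ipderiv α fun z => a z i - b z i) x +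
        ∑ j, (ipderiv α (fun y => a y j * pderiv j (fun z => a z i - b z i) y) x -
          a x j * ipderiv α (pderiv j fun z => a z i - b z i) x) := by
    rw [← Finset.sum_add_distrib]
    refine Finset.sum_congr rfl fun j _ => ?_
    rw [e10 j]
    ring
  rw [e11]
  ring

end Pointwise


/-! ## The pairings against a smooth compactly supported weight -/

section Pairings

variable {ι : Type*} [Fintype ι] [DecidableEq ι]

omit [DecidableEq ι] in
/-- Products of a continuous function with a continuous compactly supported weight are
integrable. [folklore] -/
theorem constantin_integrable_weight_mul {χ f : EuclideanSpace ℝ ι → ℝ} (hχ : Continuous χ)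
    (hχc : HasCompactSupport χ) (hf : Continuous f) :
    Integrable (fun x => χ x * f x) (volume : Measure (EuclideanSpace ℝ ι)) :=
  (hχ.mul hf).integrable_of_hasCompactSupport hχc.mul_right

/-- **The transport pairing is a pure cutoff error**: for a smooth divergence-free `a`, smooth
`G` and a smooth compactly supported weight `χ`,
`∑ⱼ ∫ χ aⱼ (∂ⱼG) G = −½ ∑ⱼ ∫ (∂ⱼχ) aⱼ G²` (`G ∂ⱼG = ½ ∂ⱼ(G²)`, integration by parts,
`∑ⱼ ∂ⱼaⱼ = 0`; the localised form of `((v·∇)w, w) = 0`, Constantin 1986, (1.9)). [cite: Constantin1986, §1 (1.9)] -/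
theorem constantin_transport_pairing_eq {a : EuclideanSpace ℝ ι → EuclideanSpace ℝ ι} {G χ : EuclideanSpace ℝ ι → ℝ}
    (ha : ContDiff ℝ ∞ a) (hdiv : ∀ x, ∑ j, pderiv j (fun y => a y j) x = 0) (hG : ContDiff ℝ ∞ G)
    (hχ : ContDiff ℝ ∞ χ) (hχc : HasCompactSupport χ) :
    ∑ j, ∫ x, χ x * (a x j * pderiv j G x * G x) =
      -(2⁻¹ * ∑ j, ∫ x, pderiv j χ x * (a x j * G x ^ 2)) := by
  have hA : ∀ j, ContDiff ℝ ∞ fun y => a y j := fun j => contDiff_comp_of_contDiff ha j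
  have hGG : ContDiff ℝ ∞ fun y => G y * G y := hG.mul hG
  have hdG : Differentiable ℝ G := hG.differentiable (by simp)
  have hχcont : Continuous χ := hχ.continuous
  have hca : Continuous a := ha.continuous
  have hcG : Continuous G := hG.continuous
  have hcpχ : ∀ j, Continuous (pderiv j χ) := fun j => continuous_pderiv hχ (by simp) j
  have hcpa : ∀ j, Continuous (pderiv j fun y => a y j) := fun j =>
    continuous_pderiv (hA j) (by simp) j
  have hcpG : ∀ j, Continuous (pderiv j G) := fun j => continuous_pderiv hG (by simp) j
  have hpGG : ∀ j x, pderiv j (fun y => G y * G y) x = 2 * (pderiv j G x * G x) := fun j x => by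
    rw [pderiv_mul hdG hdG]; ring
  -- one direction at a time
  have hj : ∀ j, ∫ x, χ x * (a x j * pderiv j G x * G x) =
      -(2⁻¹ * ((∫ x, pderiv j χ x * (a x j * G x ^ 2)) +
        ∫ x, χ x * (pderiv j (fun y => a y j) x * G x ^ 2))) := by
    intro j
    have hψ : ContDiff ℝ 1 fun y => χ y * a y j := (hχ.mul (hA j)).of_le (by norm_cast)
    have hψc : HasCompactSupport fun y => χ y * a y j := hχc.mul_right
    have h1 := integral_mul_pderiv_eq_neg hψ hψc (hGG.of_le (by norm_cast)) j
    have e1 : ∀ x, pderiv j (fun y => χ y * a y j) x =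
        pderiv j χ x * a x j + χ x * pderiv j (fun y => a y j) x := fun x => by
      rw [pderiv_mul (hχ.differentiable (by simp)) ((hA j).differentiable (by simp))]
    simp only [hpGG, e1] at h1
    have e2 : ∫ x, χ x * (a x j * pderiv j G x * G x) =
        2⁻¹ * ∫ x, χ x * a x j * (2 * (pderiv j G x * G x)) := by
      rw [← integral_const_mul (μ := volume)]
      exact integral_congr_ae (Eventually.of_forall fun x => by ring)
    have e3 : ∫ x, (pderiv j χ x * a x j + χ x * pderiv j (fun y => a y j) x) * (G x * G x) =
        (∫ x, pderiv j χ x * (a x j * G x ^ 2)) +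
          ∫ x, χ x * (pderiv j (fun y => a y j) x * G x ^ 2) := by
      rw [← integral_add]
      · exact integral_congr_ae (Eventually.of_forall fun x => by ring)
      · exact ((show Continuous fun x => pderiv j χ x * (a x j * G x ^ 2) by fun_prop)
          |>.integrable_of_hasCompactSupport ((pderiv_hasCompactSupport hχc j).mul_right))
      · exact constantin_integrable_weight_mul hχcont hχc (by fun_prop)
    rw [e2, h1, e3]
    ring
  -- the divergence-free cancellation
  have hsum0 : ∑ j, ∫ x, χ x * (pderiv j (fun y => a y j) x * G x ^ 2) = 0 := by
    rw [← integral_finsetSum _ fun j _ => constantin_integrable_weight_mul hχcont hχc (by fun_prop)]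
    have e : ∀ x, ∑ j, χ x * (pderiv j (fun y => a y j) x * G x ^ 2) = 0 := fun x => by
      rw [← Finset.mul_sum, ← Finset.sum_mul, hdiv x, zero_mul, mul_zero]
    simp [e]
  simp only [hj]
  rw [Finset.sum_neg_distrib, ← Finset.mul_sum, Finset.sum_add_distrib, hsum0, add_zero]

/-- **The viscous pairing in one direction**: for smooth `G`, `B`, a smooth compactly supported
weight `χ` and a direction `j`,
`∫ χ ∂ⱼ∂ⱼ(G + B) G = −∫ χ (∂ⱼG)² − ∫ (∂ⱼχ) G ∂ⱼG + ∫ χ (∂ⱼ∂ⱼB) G` (integration by parts once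
in the `G`-part; Constantin 1986, (1.9) `−ν(Δw,w)_m ≥ 0`, localised, plus the forcing `νΔv`). [cite: Constantin1986, §1 (1.9)-(1.10)] -/
theorem constantin_viscous_pairing_eq {G B χ : EuclideanSpace ℝ ι → ℝ} (hG : ContDiff ℝ ∞ G) (hB : ContDiff ℝ ∞ B)
    (hχ : ContDiff ℝ ∞ χ) (hχc : HasCompactSupport χ) (j : ι) :
    ∫ x, χ x * (pderiv j (pderiv j fun y => G y + B y) x * G x) =
      -(∫ x, χ x * pderiv j G x ^ 2) - (∫ x, pderiv j χ x * (G x * pderiv j G x)) +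
        ∫ x, χ x * (pderiv j (pderiv j B) x * G x) := by
  have hdG : Differentiable ℝ G := hG.differentiable (by simp)
  have hdB : Differentiable ℝ B := hB.differentiable (by simp)
  have hχcont : Continuous χ := hχ.continuous
  have hpG : ContDiff ℝ ∞ (pderiv j G) := contDiff_pderiv hG j
  have hpB : ContDiff ℝ ∞ (pderiv j B) := contDiff_pderiv hB j
  have hcG : Continuous G := hG.continuous
  have hcpχ : Continuous (pderiv j χ) := continuous_pderiv hχ (by simp) j
  have hcpG : Continuous (pderiv j G) := hpG.continuous
  have hcppG : Continuous (pderiv j (pderiv j G)) := (contDiff_pderiv hpG j).continuous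
  have hcppB : Continuous (pderiv j (pderiv j B)) := (contDiff_pderiv hpB j).continuous
  -- `∂ⱼ∂ⱼ(G + B) = ∂ⱼ∂ⱼG + ∂ⱼ∂ⱼB`
  have e1 : ∀ x, pderiv j (pderiv j fun y => G y + B y) x =
      pderiv j (pderiv j G) x + pderiv j (pderiv j B) x := fun x => by
    rw [pderiv_add hdG hdB, pderiv_add (hpG.differentiable (by simp)) (hpB.differentiable (by simp))]
  -- integration by parts in the `G`-part
  have hψ : ContDiff ℝ 1 fun y => χ y * G y := (hχ.mul hG).of_le (by norm_cast)
  have hψc : HasCompactSupport fun y => χ y * G y := hχc.mul_right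
  have h1 := integral_mul_pderiv_eq_neg hψ hψc (hpG.of_le (by norm_cast)) j
  have e2 : ∀ x, pderiv j (fun y => χ y * G y) x = pderiv j χ x * G x + χ x * pderiv j G x := fun x => by
    rw [pderiv_mul (hχ.differentiable (by simp)) hdG]
  simp only [e2] at h1
  -- `h1 : ∫ χ G ∂ⱼ∂ⱼG = -∫ (∂ⱼχ G + χ ∂ⱼG) ∂ⱼG`
  have e3 : ∫ x, (pderiv j χ x * G x + χ x * pderiv j G x) * pderiv j G x =
      (∫ x, pderiv j χ x * (G x * pderiv j G x)) + ∫ x, χ x * pderiv j G x ^ 2 := by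
    rw [← integral_add]
    · exact integral_congr_ae (Eventually.of_forall fun x => by ring)
    · exact ((show Continuous fun x => pderiv j χ x * (G x * pderiv j G x) by fun_prop)
        |>.integrable_of_hasCompactSupport ((pderiv_hasCompactSupport hχc j).mul_right))
    · exact (constantin_integrable_weight_mul hχcont hχc (show Continuous fun x => pderiv j G x ^ 2 by fun_prop)).congr
        (Eventually.of_forall fun x => by ring)
  have e4 : ∫ x, χ x * (pderiv j (pderiv j fun y => G y + B y) x * G x) =
      (∫ x, χ x * G x * pderiv j (pderiv j G) x) + ∫ x, χ x * (pderiv j (pderiv j B) x * G x) := by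
    rw [← integral_add]
    · exact integral_congr_ae (Eventually.of_forall fun x => by simp only [e1]; ring)
    · exact (constantin_integrable_weight_mul hχcont hχc (show Continuous fun x => G x * pderiv j (pderiv j G) x by
        fun_prop)).congr (Eventually.of_forall fun x => by ring)
    · exact constantin_integrable_weight_mul hχcont hχc (by fun_prop)
  rw [e4, h1, e3]
  ring

end Pairings

/-! ## The pressure pairing -/

section Pressure

variable {ι : Type*} [Fintype ι] [DecidableEq ι]

/-- **The pressure pairing, after integration by parts.** For a smooth divergence-free `w`,
smooth `r` (the pressure difference), a smooth compactly supported weight `χ` and a word `α`,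
with `Gᵢ = ∂^α wᵢ`:
`∑ᵢ ∫ χ (∂ᵢ∂^α r) Gᵢ = −(−1)^{|α|} ∫ r ∂^α Φ`, `Φ = ∑ᵢ (∂ᵢχ) Gᵢ`
(move `∂ᵢ` onto `χGᵢ`, use `∑ᵢ ∂ᵢGᵢ = ∂^α div w = 0`, then move `∂^α` onto `Φ`): every term of
`Φ` carries a derivative of the weight, so the pressure contributes only a cutoff error
(Constantin 1986, (1.9): `(∇r, w)_m = 0`). [cite: Constantin1986, §1 (1.9)] -/
theorem constantin_pressure_pairing_eq {w : ι → EuclideanSpace ℝ ι → ℝ} {r χ : EuclideanSpace ℝ ι → ℝ}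
    (hw : ∀ i, ContDiff ℝ ∞ (w i)) (hdiv : ∀ x, ∑ i, pderiv i (w i) x = 0) (hr : ContDiff ℝ ∞ r)
    (hχ : ContDiff ℝ ∞ χ) (hχc : HasCompactSupport χ) {n : ℕ} (α : Fin n → ι) :
    ∑ i, ∫ x, χ x * (pderiv i (ipderiv α r) x * ipderiv α (w i) x) =
      -((-1) ^ n * ∫ x, r x *
        ipderiv α (fun y => ∑ i, pderiv i χ y * ipderiv α (w i) y) x) := by
  have hG : ∀ i, ContDiff ℝ ∞ (ipderiv α (w i)) := fun i => contDiff_ipderiv (hw i) α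
  have hH : ContDiff ℝ ∞ (ipderiv α r) := contDiff_ipderiv hr α
  have hχcont : Continuous χ := hχ.continuous
  -- `∑ᵢ ∂ᵢ Gᵢ = 0`
  have hdivG : ∀ x, ∑ i, pderiv i (ipderiv α (w i)) x = 0 := by
    intro x
    have e : ∀ i, pderiv i (ipderiv α (w i)) x = ipderiv α (pderiv i (w i)) x :=
      fun i => by rw [pderiv_ipderiv (hw i)]
    simp only [e]
    have := congrFun (ipderiv_finset_sum Finset.univ (f := fun i y => pderiv i (w i) y)
      (fun i => contDiff_pderiv (hw i) i) α) x
    rw [← this]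
    have h0 : (fun y => ∑ i, pderiv i (w i) y) = fun _ => (0 : ℝ) := funext hdiv
    rw [h0, ipderiv_zero_fun]
  -- `Φ = ∑ᵢ ∂ᵢ(χ Gᵢ)` pointwise
  have hΦ : ∀ y, ∑ i, pderiv i χ y * ipderiv α (w i) y =
      ∑ i, pderiv i (fun z => χ z * ipderiv α (w i) z) y := by
    intro y
    have e : ∀ i, pderiv i (fun z => χ z * ipderiv α (w i) z) y =
        pderiv i χ y * ipderiv α (w i) y + χ y * pderiv i (ipderiv α (w i)) y :=
      fun i => by rw [pderiv_mul (hχ.differentiable (by simp)) ((hG i).differentiable (by simp))]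
    simp only [e, Finset.sum_add_distrib, ← Finset.mul_sum, hdivG y, mul_zero, add_zero]
  -- step 1: move `∂ᵢ`
  have h1 : ∀ i, ∫ x, χ x * (pderiv i (ipderiv α r) x * ipderiv α (w i) x) =
      -∫ x, pderiv i (fun z => χ z * ipderiv α (w i) z) x * ipderiv α r x := by
    intro i
    have hψ : ContDiff ℝ 1 fun z => χ z * ipderiv α (w i) z :=
      (hχ.mul (hG i)).of_le (by norm_cast)
    have hψc : HasCompactSupport fun z => χ z * ipderiv α (w i) z := hχc.mul_right
    have h := integral_mul_pderiv_eq_neg hψ hψc (hH.of_le (by norm_cast)) i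
    rw [← h]
    exact integral_congr_ae (Eventually.of_forall fun x => by ring)
  -- step 2: collect the sum inside the integral
  have hΦsmooth : ContDiff ℝ ∞ fun y => ∑ i, pderiv i χ y * ipderiv α (w i) y :=
    ContDiff.sum fun i _ => (contDiff_pderiv hχ i).mul (hG i)
  have hΦc : HasCompactSupport fun y => ∑ i, pderiv i χ y * ipderiv α (w i) y := by
    refine hχc.fderiv (𝕜 := ℝ) |>.mono ?_
    intro y hy
    rw [Function.mem_support] at hy ⊢
    contrapose! hy
    have : ∀ i, pderiv i χ y = 0 := fun i => by rw [pderiv_apply, hy]; rfl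
    simp [this]
  have h2 : ∑ i, ∫ x, χ x * (pderiv i (ipderiv α r) x * ipderiv α (w i) x) =
      -∫ x, ipderiv α r x * ∑ i, pderiv i χ x * ipderiv α (w i) x := by
    simp only [h1, Finset.sum_neg_distrib]
    congr 1
    rw [← integral_finsetSum _ fun i _ => ?_]
    · refine integral_congr_ae (Eventually.of_forall fun x => ?_)
      simp only [hΦ x, Finset.mul_sum]
      exact Finset.sum_congr rfl fun i _ => by ring
    · have hc : Continuous fun x => pderiv i (fun z => χ z * ipderiv α (w i) z) x * ipderiv α r x :=
        (continuous_pderiv (hχ.mul (hG i)) (by simp) i).mul hH.continuous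
      exact hc.integrable_of_hasCompactSupport
        ((pderiv_hasCompactSupport (hχc.mul_right (f' := ipderiv α (w i))) i).mul_right)
  -- step 3: move `∂^α`
  rw [h2, integral_ipderiv_mul_eq hr α hΦsmooth hΦc]

/-- The pressure test function integrates to zero: `∫ ∂^α Φ = 0`, since
`∂^α Φ = ∑ᵢ ∂ᵢ ∂^α(χ Gᵢ)` is a sum of derivatives of compactly supported functions
(`∑ᵢ χ ∂ᵢGᵢ = 0`). Hence the undetermined constant in the pressure difference drops out. [folklore] -/
theorem constantin_integral_ipderiv_pressureTest_eq_zero {w : ι → EuclideanSpace ℝ ι → ℝ}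
    {χ : EuclideanSpace ℝ ι → ℝ} (hw : ∀ i, ContDiff ℝ ∞ (w i)) (hdiv : ∀ x, ∑ i, pderiv i (w i) x = 0)
    (hχ : ContDiff ℝ ∞ χ) (hχc : HasCompactSupport χ) {n : ℕ} (α : Fin n → ι) :
    ∫ x, ipderiv α (fun y => ∑ i, pderiv i χ y * ipderiv α (w i) y) x = 0 := by
  have hG : ∀ i, ContDiff ℝ ∞ (ipderiv α (w i)) := fun i => contDiff_ipderiv (hw i) α
  have hdivG : ∀ x, ∑ i, pderiv i (ipderiv α (w i)) x = 0 := by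
    intro x
    have e : ∀ i, pderiv i (ipderiv α (w i)) x = ipderiv α (pderiv i (w i)) x :=
      fun i => by rw [pderiv_ipderiv (hw i)]
    simp only [e]
    have := congrFun (ipderiv_finset_sum Finset.univ (f := fun i y => pderiv i (w i) y)
      (fun i => contDiff_pderiv (hw i) i) α) x
    rw [← this]
    have h0 : (fun y => ∑ i, pderiv i (w i) y) = fun _ => (0 : ℝ) := funext hdiv
    rw [h0, ipderiv_zero_fun]
  -- `Φ = ∑ᵢ ∂ᵢ(χ Gᵢ)` as functions
  have hΦ : (fun y => ∑ i, pderiv i χ y * ipderiv α (w i) y) =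
      fun y => ∑ i, pderiv i (fun z => χ z * ipderiv α (w i) z) y := by
    funext y
    have e : ∀ i, pderiv i (fun z => χ z * ipderiv α (w i) z) y =
        pderiv i χ y * ipderiv α (w i) y + χ y * pderiv i (ipderiv α (w i)) y :=
      fun i => by rw [pderiv_mul (hχ.differentiable (by simp)) ((hG i).differentiable (by simp))]
    simp only [e, Finset.sum_add_distrib, ← Finset.mul_sum, hdivG y, mul_zero, add_zero]
  have hF : ∀ i, ContDiff ℝ ∞ fun z => χ z * ipderiv α (w i) z := fun i => hχ.mul (hG i)
  rw [hΦ, ipderiv_finset_sum Finset.univ (f := fun i y => pderiv i (fun z => χ z * ipderiv α (w i) z) y)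
    (fun i => contDiff_pderiv (hF i) i) α]
  simp only
  have e2 : ∀ i x, ipderiv α (pderiv i fun z => χ z * ipderiv α (w i) z) x =
      pderiv i (ipderiv α fun z => χ z * ipderiv α (w i) z) x := fun i x => by
    rw [ipderiv_pderiv (hF i)]
  simp only [e2]
  rw [integral_finsetSum _ fun i _ => ?_]
  · refine Finset.sum_eq_zero fun i _ => ?_
    exact integral_pderiv_eq_zero ((contDiff_ipderiv (hF i) α).of_le (by norm_cast))
      (ipderiv_hasCompactSupport (hχc.mul_right (f' := ipderiv α (w i))) α) i
  · exact (continuous_pderiv (contDiff_ipderiv (hF i) α) (by simp) i).integrable_of_hasCompactSupport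
      (pderiv_hasCompactSupport (ipderiv_hasCompactSupport
        (hχc.mul_right (f' := ipderiv α (w i))) α) i)

/-- **Pointwise bound of the pressure test function**: with `Gᵢ = ∂^α wᵢ`,
`|∂^α Φ (x)| ≤ 2^{|α|} ∑ᵢ ∑_{k ≤ |α|} |∇^{k+1} χ (x)| |∇^{|α|-k} Gᵢ (x)|` — every term carries at
least one derivative of the weight (full Leibniz bound, `|∇ᵏ ∂ᵢχ| ≤ |∇^{k+1} χ|`). [folklore] -/
theorem constantin_abs_ipderiv_pressureTest_le {w : ι → EuclideanSpace ℝ ι → ℝ} {χ : EuclideanSpace ℝ ι → ℝ}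
    (hw : ∀ i, ContDiff ℝ ∞ (w i)) (hχ : ContDiff ℝ ∞ χ) {n : ℕ} (α : Fin n → ι) (x : EuclideanSpace ℝ ι) :
    |ipderiv α (fun y => ∑ i, pderiv i χ y * ipderiv α (w i) y) x| ≤
      2 ^ n * ∑ i, ∑ k ∈ Finset.range (n + 1),
        dnorm (k + 1) χ x * dnorm (n - k) (ipderiv α (w i)) x := by
  have hG : ∀ i, ContDiff ℝ ∞ (ipderiv α (w i)) := fun i => contDiff_ipderiv (hw i) α
  rw [ipderiv_finset_sum Finset.univ (f := fun i y => pderiv i χ y * ipderiv α (w i) y)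
    (fun i => (contDiff_pderiv hχ i).mul (hG i)) α]
  simp only
  refine (Finset.abs_sum_le_sum_abs _ _).trans ?_
  rw [Finset.mul_sum]
  refine Finset.sum_le_sum fun i _ => ?_
  refine (abs_ipderiv_mul_le (contDiff_pderiv hχ i) (hG i) α x).trans ?_
  refine mul_le_mul_of_nonneg_left (Finset.sum_le_sum fun k _ => ?_) (by positivity)
  exact mul_le_mul_of_nonneg_right (dnorm_pderiv_le hχ k i x) (dnorm_nonneg _ _ _)

end Pressure

/-! ## `L²` sizes of the players in terms of the level integrals -/

section Levels

variable {ι : Type*} [Fintype ι] [DecidableEq ι]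

/-- One component of a sum of nonnegative integrable coordinate tensors is integrable, with
smaller integral. [folklore] -/
theorem constantin_integrable_dnormSq_of_sum {w : ι → EuclideanSpace ℝ ι → ℝ} (hw : ∀ i, ContDiff ℝ ∞ (w i)) (m : ℕ)
    (hI : Integrable (fun x => ∑ i, dnormSq m (w i) x) (volume : Measure (EuclideanSpace ℝ ι))) (i : ι) :
    Integrable (dnormSq m (w i)) (volume : Measure (EuclideanSpace ℝ ι)) ∧
      ∫ x, dnormSq m (w i) x ≤ ∫ x, ∑ j, dnormSq m (w j) x := by
  have hle : ∀ x, dnormSq m (w i) x ≤ ∑ j, dnormSq m (w j) x := fun x =>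
    Finset.single_le_sum (f := fun j => dnormSq m (w j) x) (fun _ _ => dnormSq_nonneg _ _ _)
      (Finset.mem_univ i)
  have hint : Integrable (dnormSq m (w i)) :=
    hI.mono' (continuous_dnormSq (hw i) m).aestronglyMeasurable (Eventually.of_forall fun x => by
      rw [Real.norm_of_nonneg (dnormSq_nonneg _ _ _)]; exact hle x)
  exact ⟨hint, integral_mono hint hI hle⟩

/-- **A word derivative of a component is in `L²` with norm at most the level integral**:
`∫ (∂^β wᵢ)² ≤ ∫ ∑ⱼ |∇^m wⱼ|²`, `|β| = m`. [folklore] -/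
theorem constantin_memLp_ipderiv_and_le {w : ι → EuclideanSpace ℝ ι → ℝ} (hw : ∀ i, ContDiff ℝ ∞ (w i)) {m : ℕ}
    (hI : Integrable (fun x => ∑ i, dnormSq m (w i) x) (volume : Measure (EuclideanSpace ℝ ι)))
    (β : Fin m → ι) (i : ι) :
    MemLp (ipderiv β (w i)) 2 (volume : Measure (EuclideanSpace ℝ ι)) ∧
      Real.sqrt (∫ x, ipderiv β (w i) x ^ 2) ≤ Real.sqrt (∫ x, ∑ j, dnormSq m (w j) x) := by
  obtain ⟨hint, hle⟩ := constantin_integrable_dnormSq_of_sum hw m hI i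
  obtain ⟨hmem, hle'⟩ := memLp_ipderiv_of_integrable_dnormSq (hw i) β hint
  exact ⟨hmem, Real.sqrt_le_sqrt (hle'.trans hle)⟩

/-- **The coordinate norm of a component is in `L²` with norm at most the level integral**:
`∫ |∇^m wᵢ|² ≤ ∫ ∑ⱼ |∇^m wⱼ|²`. [folklore] -/
theorem constantin_memLp_dnorm_and_le {w : ι → EuclideanSpace ℝ ι → ℝ} (hw : ∀ i, ContDiff ℝ ∞ (w i)) (m : ℕ)
    (hI : Integrable (fun x => ∑ i, dnormSq m (w i) x) (volume : Measure (EuclideanSpace ℝ ι))) (i : ι) :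
    MemLp (dnorm m (w i)) 2 (volume : Measure (EuclideanSpace ℝ ι)) ∧
      Real.sqrt (∫ x, dnorm m (w i) x ^ 2) ≤ Real.sqrt (∫ x, ∑ j, dnormSq m (w j) x) := by
  obtain ⟨hint, hle⟩ := constantin_integrable_dnormSq_of_sum hw m hI i
  obtain ⟨hmem, heq⟩ := memLp_dnorm_of_integrable_dnormSq (hw i) m hint
  exact ⟨hmem, Real.sqrt_le_sqrt (heq.le.trans hle)⟩

end Levels

/-! ## Bounds of the five pairings for a fixed word -/

section Bounds

variable {ι : Type*} [Fintype ι] [DecidableEq ι]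

/-- **The transport term is a cutoff error**: with `Gᵢ = ∂^α wᵢ`, `|aⱼ| ≤ B_a`,
`|∂ⱼχ_R| ≤ A/R`,
`−∑ᵢ ∫ χ (∑ⱼ aⱼ ∂ⱼGᵢ) Gᵢ ≤ ½ (card ι)² (A/R) B_a ∫ ∑ᵢ|∇ⁿwᵢ|²`. [cite: Constantin1986, §1 (1.9)] -/
theorem constantin_transport_term_le {a : EuclideanSpace ℝ ι → EuclideanSpace ℝ ι} {w : ι → EuclideanSpace ℝ ι → ℝ}
    {χ : EuclideanSpace ℝ ι → ℝ} (ha : ContDiff ℝ ∞ a) (hdiv : ∀ x, ∑ j, pderiv j (fun y => a y j) x = 0)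
    (hw : ∀ i, ContDiff ℝ ∞ (w i)) (hχ : ContDiff ℝ ∞ χ) (hχc : HasCompactSupport χ)
    {n : ℕ} (α : Fin n → ι)
    (hI : Integrable (fun x => ∑ i, dnormSq n (w i) x) (volume : Measure (EuclideanSpace ℝ ι)))
    {Ba AR : ℝ} (hBa0 : 0 ≤ Ba) (hBa : ∀ x j, |a x j| ≤ Ba) (hAR0 : 0 ≤ AR)
    (hAR : ∀ j x, |pderiv j χ x| ≤ AR) :
    -∑ i, ∫ x, χ x * ((∑ j, a x j * pderiv j (ipderiv α (w i)) x) * ipderiv α (w i) x) ≤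
      2⁻¹ * (Fintype.card ι) ^ 2 * AR * Ba * ∫ x, ∑ i, dnormSq n (w i) x := by
  set L : ℝ := ∫ x, ∑ i, dnormSq n (w i) x with hL
  have hL0 : 0 ≤ L := integral_nonneg fun x => Finset.sum_nonneg fun i _ => dnormSq_nonneg _ _ _
  -- the identity, component by component
  have hT : ∀ i, ∫ x, χ x * ((∑ j, a x j * pderiv j (ipderiv α (w i)) x) * ipderiv α (w i) x) =
      -(2⁻¹ * ∑ j, ∫ x, pderiv j χ x * (a x j * ipderiv α (w i) x ^ 2)) := by
    intro i
    have hG : ContDiff ℝ ∞ (ipderiv α (w i)) := contDiff_ipderiv (hw i) α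
    rw [← constantin_transport_pairing_eq ha hdiv hG hχ hχc]
    rw [← integral_finsetSum _ fun j _ => ?_]
    · refine integral_congr_ae (Eventually.of_forall fun x => ?_)
      simp only [Finset.sum_mul, Finset.mul_sum]
    · have hca : Continuous a := ha.continuous
      have hcG : Continuous (ipderiv α (w i)) := hG.continuous
      have hcdG : Continuous (pderiv j (ipderiv α (w i))) := continuous_pderiv hG (by simp) j
      exact constantin_integrable_weight_mul hχ.continuous hχc (by fun_prop)
  -- the bound for each `(i, j)`
  have hij : ∀ i j, ∫ x, pderiv j χ x * (a x j * ipderiv α (w i) x ^ 2) ≤ AR * Ba * L := by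
    intro i j
    obtain ⟨hmem, hle⟩ := constantin_memLp_ipderiv_and_le hw hI α i
    have h1 : ∫ x, pderiv j χ x * (a x j * ipderiv α (w i) x ^ 2) ≤
        AR * Ba * (Real.sqrt (∫ x, ipderiv α (w i) x ^ 2) * Real.sqrt (∫ x, ipderiv α (w i) x ^ 2)) := by
      refine integral_le_of_abs_le_mul_mul (h := fun x => a x j) hmem hmem hAR0 hBa0 (fun x => hBa x j)
        fun x => ?_
      have e : |pderiv j χ x * (a x j * ipderiv α (w i) x ^ 2)| =
          |pderiv j χ x| * (|a x j| * (|ipderiv α (w i) x| * |ipderiv α (w i) x|)) := by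
        rw [abs_mul, abs_mul, pow_two, abs_mul]
      rw [e]
      exact mul_le_mul_of_nonneg_right (hAR j x) (by positivity)
    refine h1.trans ?_
    have hAB : 0 ≤ AR * Ba := mul_nonneg hAR0 hBa0
    calc AR * Ba * (Real.sqrt (∫ x, ipderiv α (w i) x ^ 2) * Real.sqrt (∫ x, ipderiv α (w i) x ^ 2))
        ≤ AR * Ba * (Real.sqrt L * Real.sqrt L) :=
          mul_le_mul_of_nonneg_left (mul_le_mul hle hle (Real.sqrt_nonneg _) (Real.sqrt_nonneg _)) hAB
      _ = AR * Ba * L := by rw [Real.mul_self_sqrt hL0]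
  -- assemble
  have e1 : -∑ i, ∫ x, χ x * ((∑ j, a x j * pderiv j (ipderiv α (w i)) x) * ipderiv α (w i) x) =
      2⁻¹ * ∑ i, ∑ j, ∫ x, pderiv j χ x * (a x j * ipderiv α (w i) x ^ 2) := by
    rw [Finset.sum_congr rfl fun i _ => hT i, Finset.sum_neg_distrib, neg_neg, ← Finset.mul_sum]
  rw [e1]
  calc 2⁻¹ * ∑ i, ∑ j, ∫ x, pderiv j χ x * (a x j * ipderiv α (w i) x ^ 2)
      ≤ 2⁻¹ * ∑ _i : ι, ∑ _j : ι, AR * Ba * L := by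
        refine mul_le_mul_of_nonneg_left (Finset.sum_le_sum fun i _ => Finset.sum_le_sum fun j _ => hij i j)
          (by norm_num)
    _ = 2⁻¹ * (Fintype.card ι) ^ 2 * AR * Ba * L := by
        rw [Finset.sum_const, Finset.sum_const, Finset.card_univ, nsmul_eq_mul, nsmul_eq_mul]
        ring

/-- **The viscous term: dissipation discarded, a cutoff error and the forcing `νΔb`.** With
`Gᵢ = ∂^α wᵢ`, `aᵢ = wᵢ + bᵢ`, `0 ≤ χ ≤ 1`, `|∂ⱼχ| ≤ A/R` and `ν ≥ 0`:
`∑ᵢ ∫ χ (ν ∑ⱼ ∂ⱼ∂ⱼ∂^α aᵢ) Gᵢ ≤ ν (card ι)² [ (A/R) ‖∇ⁿw‖₂ ‖∇ⁿ⁺¹w‖₂ + ‖∇ⁿ⁺²b‖₂ ‖∇ⁿw‖₂ ]`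
(Constantin 1986, (1.9)–(1.10): `−ν(Δw, w)_m ≥ 0` and `ν(Δv, w)_m ≤ ν‖Δv‖_m ‖w‖_m`). [cite: Constantin1986, §1 (1.9)-(1.10)] -/
theorem constantin_viscous_term_le {a b : EuclideanSpace ℝ ι → EuclideanSpace ℝ ι} {w : ι → EuclideanSpace ℝ ι → ℝ}
    {χ : EuclideanSpace ℝ ι → ℝ} (ha : ContDiff ℝ ∞ a) (hb : ContDiff ℝ ∞ b) (hw : ∀ i, ContDiff ℝ ∞ (w i))
    (hwab : ∀ i y, w i y = a y i - b y i) (hχ : ContDiff ℝ ∞ χ) (hχc : HasCompactSupport χ)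
    (hχ0 : ∀ x, 0 ≤ χ x) (hχ1 : ∀ x, χ x ≤ 1) {n : ℕ} (α : Fin n → ι)
    (hIn : Integrable (fun x => ∑ i, dnormSq n (w i) x) (volume : Measure (EuclideanSpace ℝ ι)))
    (hIn1 : Integrable (fun x => ∑ i, dnormSq (n + 1) (w i) x) (volume : Measure (EuclideanSpace ℝ ι)))
    (hIb : Integrable (fun x => ∑ i, dnormSq (n + 2) (fun y => b y i) x) (volume : Measure (EuclideanSpace ℝ ι)))
    {ν AR : ℝ} (hν : 0 ≤ ν) (hAR0 : 0 ≤ AR) (hAR : ∀ j x, |pderiv j χ x| ≤ AR) :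
    ∑ i, ∫ x, χ x * ((ν * ∑ j, pderiv j (pderiv j (ipderiv α fun z => a z i)) x) * ipderiv α (w i) x) ≤
      ν * (Fintype.card ι) ^ 2 *
        (AR * Real.sqrt (∫ x, ∑ i, dnormSq n (w i) x) * Real.sqrt (∫ x, ∑ i, dnormSq (n + 1) (w i) x) +
          Real.sqrt (∫ x, ∑ i, dnormSq (n + 2) (fun y => b y i) x) *
            Real.sqrt (∫ x, ∑ i, dnormSq n (w i) x)) := by
  set Ln : ℝ := ∫ x, ∑ i, dnormSq n (w i) x with hLn
  set Ln1 : ℝ := ∫ x, ∑ i, dnormSq (n + 1) (w i) x with hLn1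
  set Lb : ℝ := ∫ x, ∑ i, dnormSq (n + 2) (fun y => b y i) x with hLb
  have hB : ∀ i, ContDiff ℝ ∞ fun y => b y i := fun i => contDiff_comp_of_contDiff hb i
  have hG : ∀ i, ContDiff ℝ ∞ (ipderiv α (w i)) := fun i => contDiff_ipderiv (hw i) α
  have hBi : ∀ i, ContDiff ℝ ∞ (ipderiv α fun y => b y i) := fun i => contDiff_ipderiv (hB i) α
  -- `∂^α aᵢ = Gᵢ + Bᵢ`
  have hA : ∀ i, (ipderiv α fun z => a z i) = fun y => ipderiv α (w i) y + ipderiv α (fun z => b z i) y := by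
    intro i
    have e : (fun z => a z i) = fun y => w i y + b y i := funext fun y => by rw [hwab i y]; ring
    rw [e, ipderiv_add (hw i) (hB i)]
  -- the three pieces for each `(i, j)`
  have hij : ∀ i j, ∫ x, χ x * (pderiv j (pderiv j (ipderiv α fun z => a z i)) x * ipderiv α (w i) x) ≤
      AR * Real.sqrt Ln * Real.sqrt Ln1 + Real.sqrt Lb * Real.sqrt Ln := by
    intro i j
    rw [hA i, constantin_viscous_pairing_eq (hG i) (hBi i) hχ hχc j]
    obtain ⟨mG, leG⟩ := constantin_memLp_ipderiv_and_le hw hIn α i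
    obtain ⟨mdG, ledG⟩ := constantin_memLp_ipderiv_and_le hw hIn1 (Fin.cons j α) i
    rw [ipderiv_cons] at mdG ledG
    obtain ⟨mddB, leddB⟩ := constantin_memLp_ipderiv_and_le (w := fun i y => b y i) hB hIb
      (Fin.cons j (Fin.cons j α) : Fin (n + 2) → ι) i
    rw [ipderiv_cons, ipderiv_cons] at mddB leddB
    -- dissipation
    have h1 : -(∫ x, χ x * pderiv j (ipderiv α (w i)) x ^ 2) ≤ 0 :=
      neg_nonpos.2 (integral_nonneg fun x => mul_nonneg (hχ0 x) (sq_nonneg _))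
    -- cutoff error
    have h2 : -(∫ x, pderiv j χ x * (ipderiv α (w i) x * pderiv j (ipderiv α (w i)) x)) ≤
        AR * (Real.sqrt (∫ x, ipderiv α (w i) x ^ 2) *
          Real.sqrt (∫ x, pderiv j (ipderiv α (w i)) x ^ 2)) := by
      rw [← integral_neg]
      refine integral_le_of_abs_le_mul mG mdG hAR0 fun x => ?_
      rw [abs_neg, abs_mul, abs_mul]
      exact mul_le_mul_of_nonneg_right (hAR j x) (by positivity)
    -- forcing
    have h3 : ∫ x, χ x * (pderiv j (pderiv j (ipderiv α fun y => b y i)) x * ipderiv α (w i) x) ≤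
        1 * (Real.sqrt (∫ x, pderiv j (pderiv j (ipderiv α fun y => b y i)) x ^ 2) *
          Real.sqrt (∫ x, ipderiv α (w i) x ^ 2)) := by
      refine integral_le_of_abs_le_mul mddB mG zero_le_one fun x => ?_
      rw [abs_mul, abs_mul, one_mul]
      exact mul_le_of_le_one_left (by positivity) (abs_le.2 ⟨by linarith [hχ0 x], hχ1 x⟩)
    have hs := Real.sqrt_nonneg
    calc -(∫ x, χ x * pderiv j (ipderiv α (w i)) x ^ 2) -
          (∫ x, pderiv j χ x * (ipderiv α (w i) x * pderiv j (ipderiv α (w i)) x)) +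
          ∫ x, χ x * (pderiv j (pderiv j (ipderiv α fun y => b y i)) x * ipderiv α (w i) x)
        ≤ 0 + AR * (Real.sqrt (∫ x, ipderiv α (w i) x ^ 2) *
            Real.sqrt (∫ x, pderiv j (ipderiv α (w i)) x ^ 2)) +
          1 * (Real.sqrt (∫ x, pderiv j (pderiv j (ipderiv α fun y => b y i)) x ^ 2) *
            Real.sqrt (∫ x, ipderiv α (w i) x ^ 2)) := by linarith
      _ ≤ 0 + AR * (Real.sqrt Ln * Real.sqrt Ln1) + 1 * (Real.sqrt Lb * Real.sqrt Ln) := by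
          gcongr
      _ = AR * Real.sqrt Ln * Real.sqrt Ln1 + Real.sqrt Lb * Real.sqrt Ln := by ring
  -- linearity in `i`: pull out `ν ∑ⱼ`
  have hlin : ∀ i, ∫ x, χ x * ((ν * ∑ j, pderiv j (pderiv j (ipderiv α fun z => a z i)) x) * ipderiv α (w i) x) =
      ν * ∑ j, ∫ x, χ x * (pderiv j (pderiv j (ipderiv α fun z => a z i)) x * ipderiv α (w i) x) := by
    intro i
    have hAi : ContDiff ℝ ∞ (ipderiv α fun z => a z i) := contDiff_ipderiv (contDiff_comp_of_contDiff ha i) α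
    rw [← integral_finsetSum _ fun j _ => ?_, ← integral_const_mul]
    · refine integral_congr_ae (Eventually.of_forall fun x => ?_)
      simp only [Finset.sum_mul, Finset.mul_sum]
      exact Finset.sum_congr rfl fun j _ => by ring
    · have hc1 : Continuous (pderiv j (pderiv j (ipderiv α fun z => a z i))) :=
        (contDiff_pderiv (contDiff_pderiv hAi j) j).continuous
      have hc2 : Continuous (ipderiv α (w i)) := (hG i).continuous
      exact constantin_integrable_weight_mul hχ.continuous hχc (by fun_prop)
  simp only [hlin]
  rw [← Finset.mul_sum]
  calc ν * ∑ i, ∑ j, ∫ x, χ x * (pderiv j (pderiv j (ipderiv α fun z => a z i)) x * ipderiv α (w i) x)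
      ≤ ν * ∑ _i : ι, ∑ _j : ι, (AR * Real.sqrt Ln * Real.sqrt Ln1 + Real.sqrt Lb * Real.sqrt Ln) :=
        mul_le_mul_of_nonneg_left (Finset.sum_le_sum fun i _ => Finset.sum_le_sum fun j _ => hij i j) hν
    _ = ν * (Fintype.card ι) ^ 2 * (AR * Real.sqrt Ln * Real.sqrt Ln1 + Real.sqrt Lb * Real.sqrt Ln) := by
        rw [Finset.sum_const, Finset.sum_const, Finset.card_univ, nsmul_eq_mul, nsmul_eq_mul]
        ring

/-- **The linear term `(w·∇)b`.** With `Gᵢ = ∂^α wᵢ`, `|∇ᵏbᵢ| ≤ B_b` for `k ≤ n + 1`, `|χ| ≤ 1`: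
`−∑ᵢ ∫ χ (∑ⱼ ∂^α(wⱼ ∂ⱼbᵢ)) Gᵢ ≤ 2ⁿ (card ι)² B_b (∑_{k ≤ n} ‖∇ᵏw‖₂) ‖∇ⁿw‖₂` (full Leibniz
bound, Cauchy–Schwarz; Constantin 1986, (1.8): `|((w·∇)v, w)_m| ≤ c‖v‖_{m+1}‖w‖²_m`, here with
the sup norms of `∇ᵏv` in place of `‖v‖_{m+1}`). [cite: Constantin1986, §1 (1.8)] -/
theorem constantin_linear_term_le {b : EuclideanSpace ℝ ι → EuclideanSpace ℝ ι} {w : ι → EuclideanSpace ℝ ι → ℝ}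
    {χ : EuclideanSpace ℝ ι → ℝ} (hb : ContDiff ℝ ∞ b) (hw : ∀ i, ContDiff ℝ ∞ (w i))
    (hχ : ContDiff ℝ ∞ χ) (hχc : HasCompactSupport χ) (hχ0 : ∀ x, 0 ≤ χ x) (hχ1 : ∀ x, χ x ≤ 1)
    {n : ℕ} (α : Fin n → ι)
    (hI : ∀ k, k ≤ n → Integrable (fun x => ∑ i, dnormSq k (w i) x) (volume : Measure (EuclideanSpace ℝ ι)))
    {Bb : ℝ} (hBb0 : 0 ≤ Bb) (hBb : ∀ k, k ≤ n + 1 → ∀ i x, dnorm k (fun y => b y i) x ≤ Bb) :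
    -∑ i, ∫ x, χ x * ((∑ j, ipderiv α (fun y => w j y * pderiv j (fun z => b z i) y) x) * ipderiv α (w i) x) ≤
      2 ^ n * (Fintype.card ι) ^ 2 * Bb *
        (∑ k ∈ Finset.range (n + 1), Real.sqrt (∫ x, ∑ i, dnormSq k (w i) x)) *
          Real.sqrt (∫ x, ∑ i, dnormSq n (w i) x) := by
  set L : ℕ → ℝ := fun k => ∫ x, ∑ i, dnormSq k (w i) x with hL
  have hB : ∀ i, ContDiff ℝ ∞ fun y => b y i := fun i => contDiff_comp_of_contDiff hb i
  have hG : ∀ i, ContDiff ℝ ∞ (ipderiv α (w i)) := fun i => contDiff_ipderiv (hw i) α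
  have hχcont : Continuous χ := hχ.continuous
  -- pointwise Leibniz bound of one `(i, j)` integrand
  have hpt : ∀ i j x, -(χ x * (ipderiv α (fun y => w j y * pderiv j (fun z => b z i) y) x * ipderiv α (w i) x)) ≤
      ∑ k ∈ Finset.range (n + 1), 2 ^ n * (dnorm k (w j) x * (dnorm (n - k + 1) (fun z => b z i) x *
        |ipderiv α (w i) x|)) := by
    intro i j x
    have hleib := abs_ipderiv_mul_le (hw j) (contDiff_pderiv (hB i) j) α x
    have h1 : -(χ x * (ipderiv α (fun y => w j y * pderiv j (fun z => b z i) y) x * ipderiv α (w i) x)) ≤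
        |ipderiv α (fun y => w j y * pderiv j (fun z => b z i) y) x| * |ipderiv α (w i) x| := by
      refine (neg_le_abs _).trans ?_
      rw [abs_mul, abs_mul]
      calc |χ x| * (|ipderiv α (fun y => w j y * pderiv j (fun z => b z i) y) x| * |ipderiv α (w i) x|)
          ≤ 1 * (|ipderiv α (fun y => w j y * pderiv j (fun z => b z i) y) x| * |ipderiv α (w i) x|) :=
            mul_le_mul_of_nonneg_right (abs_le.2 ⟨by linarith [hχ0 x], hχ1 x⟩) (by positivity)
        _ = _ := one_mul _
    refine h1.trans ?_
    calc |ipderiv α (fun y => w j y * pderiv j (fun z => b z i) y) x| * |ipderiv α (w i) x|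
        ≤ (2 ^ n * ∑ k ∈ Finset.range (n + 1), dnorm k (w j) x * dnorm (n - k) (pderiv j fun z => b z i) x) *
            |ipderiv α (w i) x| := mul_le_mul_of_nonneg_right hleib (abs_nonneg _)
      _ ≤ (2 ^ n * ∑ k ∈ Finset.range (n + 1), dnorm k (w j) x * dnorm (n - k + 1) (fun z => b z i) x) *
            |ipderiv α (w i) x| := by
          refine mul_le_mul_of_nonneg_right (mul_le_mul_of_nonneg_left (Finset.sum_le_sum fun k _ => ?_)
            (by positivity)) (abs_nonneg _)
          exact mul_le_mul_of_nonneg_left (dnorm_pderiv_le (hB i) _ j x) (dnorm_nonneg _ _ _)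
      _ = ∑ k ∈ Finset.range (n + 1), 2 ^ n * (dnorm k (w j) x * (dnorm (n - k + 1) (fun z => b z i) x *
            |ipderiv α (w i) x|)) := by
          rw [mul_assoc, Finset.sum_mul, Finset.mul_sum]
          exact Finset.sum_congr rfl fun k _ => by ring
  -- each `(i, j, k)` piece
  have hijk : ∀ i j, ∀ k ∈ Finset.range (n + 1),
      Integrable (fun x => 2 ^ n * (dnorm k (w j) x * (dnorm (n - k + 1) (fun z => b z i) x *
        |ipderiv α (w i) x|))) (volume : Measure (EuclideanSpace ℝ ι)) ∧
      ∫ x, 2 ^ n * (dnorm k (w j) x * (dnorm (n - k + 1) (fun z => b z i) x * |ipderiv α (w i) x|)) ≤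
        2 ^ n * Bb * (Real.sqrt (L k) * Real.sqrt (L n)) := by
    intro i j k hk
    have hkn : k ≤ n := Nat.lt_succ_iff.1 (Finset.mem_range.1 hk)
    obtain ⟨mw, lew⟩ := constantin_memLp_dnorm_and_le hw k (hI k hkn) j
    obtain ⟨mG, leG⟩ := constantin_memLp_ipderiv_and_le hw (hI n le_rfl) α i
    have hb' : ∀ x, |dnorm (n - k + 1) (fun z => b z i) x| ≤ Bb := fun x => by
      rw [abs_of_nonneg (dnorm_nonneg _ _ _)]; exact hBb _ (by omega) i x
    have hle : ∀ x, |2 ^ n * (dnorm k (w j) x * (dnorm (n - k + 1) (fun z => b z i) x * |ipderiv α (w i) x|))| ≤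
        2 ^ n * (|dnorm (n - k + 1) (fun z => b z i) x| * (|dnorm k (w j) x| * |ipderiv α (w i) x|)) := by
      intro x
      rw [abs_mul, abs_mul, abs_mul, abs_abs, abs_of_nonneg (by positivity : (0 : ℝ) ≤ 2 ^ n)]
      exact le_of_eq (by ring)
    refine ⟨?_, ?_⟩
    · have hc : Continuous fun x => 2 ^ n * (dnorm k (w j) x * (dnorm (n - k + 1) (fun z => b z i) x *
          |ipderiv α (w i) x|)) :=
        continuous_const.mul ((continuous_dnorm (hw j) k).mul
          ((continuous_dnorm (hB i) _).mul (hG i).continuous.abs))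
      refine integrable_of_abs_le_mul hc.aestronglyMeasurable mw mG (C := 2 ^ n * Bb) fun x => (hle x).trans ?_
      calc 2 ^ n * (|dnorm (n - k + 1) (fun z => b z i) x| * (|dnorm k (w j) x| * |ipderiv α (w i) x|))
          ≤ 2 ^ n * (Bb * (|dnorm k (w j) x| * |ipderiv α (w i) x|)) :=
            mul_le_mul_of_nonneg_left (mul_le_mul_of_nonneg_right (hb' x) (by positivity)) (by positivity)
        _ = 2 ^ n * Bb * (|dnorm k (w j) x| * |ipderiv α (w i) x|) := by ring
    · refine (integral_le_of_abs_le_mul_mul mw mG (by positivity) hBb0 hb' hle).trans ?_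
      exact mul_le_mul_of_nonneg_left (mul_le_mul lew leG (Real.sqrt_nonneg _) (Real.sqrt_nonneg _))
        (by positivity)
  -- integrate the pointwise bound for each `(i, j)`
  have hij : ∀ i j, -∫ x, χ x * (ipderiv α (fun y => w j y * pderiv j (fun z => b z i) y) x * ipderiv α (w i) x) ≤
      ∑ k ∈ Finset.range (n + 1), 2 ^ n * Bb * (Real.sqrt (L k) * Real.sqrt (L n)) := by
    intro i j
    rw [← integral_neg]
    have hint1 : Integrable (fun x => -(χ x * (ipderiv α (fun y => w j y * pderiv j (fun z => b z i) y) x *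
        ipderiv α (w i) x))) (volume : Measure (EuclideanSpace ℝ ι)) := by
      refine (constantin_integrable_weight_mul hχcont hχc ?_).neg
      exact (contDiff_ipderiv ((hw j).mul (contDiff_pderiv (hB i) j)) α).continuous.mul (hG i).continuous
    have hint2 : Integrable (fun x => ∑ k ∈ Finset.range (n + 1), 2 ^ n * (dnorm k (w j) x *
        (dnorm (n - k + 1) (fun z => b z i) x * |ipderiv α (w i) x|))) (volume : Measure (EuclideanSpace ℝ ι)) :=
      integrable_finsetSum _ fun k hk => (hijk i j k hk).1
    refine (integral_mono hint1 hint2 fun x => hpt i j x).trans ?_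
    rw [integral_finsetSum _ fun k hk => (hijk i j k hk).1]
    exact Finset.sum_le_sum fun k hk => (hijk i j k hk).2
  -- linearity in `i` and summation
  have hlin : ∀ i, ∫ x, χ x * ((∑ j, ipderiv α (fun y => w j y * pderiv j (fun z => b z i) y) x) * ipderiv α (w i) x) =
      ∑ j, ∫ x, χ x * (ipderiv α (fun y => w j y * pderiv j (fun z => b z i) y) x * ipderiv α (w i) x) := by
    intro i
    rw [← integral_finsetSum _ fun j _ => ?_]
    · refine integral_congr_ae (Eventually.of_forall fun x => ?_)
      simp only [Finset.sum_mul, Finset.mul_sum]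
    · exact constantin_integrable_weight_mul hχcont hχc
        ((contDiff_ipderiv ((hw j).mul (contDiff_pderiv (hB i) j)) α).continuous.mul (hG i).continuous)
  simp only [hlin]
  rw [← Finset.sum_neg_distrib]
  simp only [← Finset.sum_neg_distrib]
  calc ∑ i, ∑ j, -∫ x, χ x * (ipderiv α (fun y => w j y * pderiv j (fun z => b z i) y) x * ipderiv α (w i) x)
      ≤ ∑ _i : ι, ∑ _j : ι, ∑ k ∈ Finset.range (n + 1), 2 ^ n * Bb * (Real.sqrt (L k) * Real.sqrt (L n)) :=
        Finset.sum_le_sum fun i _ => Finset.sum_le_sum fun j _ => hij i j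
    _ = 2 ^ n * (Fintype.card ι) ^ 2 * Bb * (∑ k ∈ Finset.range (n + 1), Real.sqrt (L k)) * Real.sqrt (L n) := by
        rw [Finset.sum_const, Finset.sum_const, Finset.card_univ, nsmul_eq_mul, nsmul_eq_mul, ← Finset.mul_sum,
          ← Finset.sum_mul]
        ring

/-- **The commutator term.** With `Gᵢ = ∂^α wᵢ`, `a = w + b`, `|∇ᵏbⱼ| ≤ B_b` (`k ≤ n + 1`),
`0 ≤ χ ≤ 1`: the Leibniz commutators `∂^α(aⱼ∂ⱼwᵢ) − aⱼ∂^α∂ⱼwᵢ` paired with `χGᵢ` are bounded by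
`2ⁿ (card ι)² B_b (∑_{1≤k≤n} ‖∇^{n-k+1}w‖₂) ‖∇ⁿw‖₂` plus the **trilinear terms**
`2ⁿ ∑_{i,j} ∑_{1≤k≤n} ∫ χ |∇ᵏwⱼ| |∇^{n-k+1}wᵢ| |Gᵢ|`, which are kept (they are closed later by the
Sobolev imbedding; Constantin 1986, (1.8): `|((u·∇)w, w)_m| ≤ c‖u‖_{m+1}‖w‖_m²` split as
`u = v + w`). [cite: Constantin1986, §1 (1.8)] -/
theorem constantin_commutator_term_le {a b : EuclideanSpace ℝ ι → EuclideanSpace ℝ ι} {w : ι → EuclideanSpace ℝ ι → ℝ}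
    {χ : EuclideanSpace ℝ ι → ℝ} (ha : ContDiff ℝ ∞ a) (hb : ContDiff ℝ ∞ b) (hw : ∀ i, ContDiff ℝ ∞ (w i))
    (hwab : ∀ i y, w i y = a y i - b y i) (hχ : ContDiff ℝ ∞ χ) (hχc : HasCompactSupport χ)
    (hχ0 : ∀ x, 0 ≤ χ x) (hχ1 : ∀ x, χ x ≤ 1) {n : ℕ} (α : Fin n → ι)
    (hI : ∀ k, k ≤ n → Integrable (fun x => ∑ i, dnormSq k (w i) x) (volume : Measure (EuclideanSpace ℝ ι)))
    {Bb : ℝ} (hBb0 : 0 ≤ Bb) (hBb : ∀ k, k ≤ n + 1 → ∀ i x, dnorm k (fun y => b y i) x ≤ Bb) :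
    -∑ i, ∫ x, χ x * ((∑ j, (ipderiv α (fun y => a y j * pderiv j (w i) y) x -
        a x j * ipderiv α (pderiv j (w i)) x)) * ipderiv α (w i) x) ≤
      2 ^ n * (Fintype.card ι) ^ 2 * Bb *
        (∑ k ∈ Finset.Icc 1 n, Real.sqrt (∫ x, ∑ i, dnormSq (n - k + 1) (w i) x)) *
          Real.sqrt (∫ x, ∑ i, dnormSq n (w i) x) +
      2 ^ n * ∑ i, ∑ j, ∑ k ∈ Finset.Icc 1 n,
        ∫ x, χ x * (dnorm k (w j) x * (dnorm (n - k + 1) (w i) x * |ipderiv α (w i) x|)) := by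
  set L : ℕ → ℝ := fun k => ∫ x, ∑ i, dnormSq k (w i) x with hL
  have hA : ∀ j, ContDiff ℝ ∞ fun y => a y j := fun j => contDiff_comp_of_contDiff ha j
  have hB : ∀ j, ContDiff ℝ ∞ fun y => b y j := fun j => contDiff_comp_of_contDiff hb j
  have hG : ∀ i, ContDiff ℝ ∞ (ipderiv α (w i)) := fun i => contDiff_ipderiv (hw i) α
  have hχcont : Continuous χ := hχ.continuous
  have hwfun : ∀ j, (fun y => a y j - b y j) = w j := fun j => (funext (hwab j)).symm
  -- pointwise bound of one `(i, j)` integrand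
  have hpt : ∀ i j x, -(χ x * ((ipderiv α (fun y => a y j * pderiv j (w i) y) x -
      a x j * ipderiv α (pderiv j (w i)) x) * ipderiv α (w i) x)) ≤
      ∑ k ∈ Finset.Icc 1 n, (2 ^ n * (χ x * (dnorm k (fun y => b y j) x * (dnorm (n - k + 1) (w i) x *
          |ipderiv α (w i) x|))) +
        2 ^ n * (χ x * (dnorm k (w j) x * (dnorm (n - k + 1) (w i) x * |ipderiv α (w i) x|)))) := by
    intro i j x
    have hcomm := abs_ipderiv_mul_sub_mul_ipderiv_le (hA j) (contDiff_pderiv (hw i) j) α x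
    have hsplit : ∀ k, dnorm k (fun y => a y j) x ≤ dnorm k (w j) x + dnorm k (fun y => b y j) x := fun k => by
      have := dnorm_le_dnorm_sub_add (hA j) (hB j) k x
      rwa [hwfun j] at this
    have h1 : -(χ x * ((ipderiv α (fun y => a y j * pderiv j (w i) y) x -
        a x j * ipderiv α (pderiv j (w i)) x) * ipderiv α (w i) x)) ≤
        χ x * (|ipderiv α (fun y => a y j * pderiv j (w i) y) x - a x j * ipderiv α (pderiv j (w i)) x| *
          |ipderiv α (w i) x|) := by
      refine (neg_le_abs _).trans (le_of_eq ?_)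
      rw [abs_mul, abs_mul, abs_of_nonneg (hχ0 x)]
    refine h1.trans ?_
    have h2 : |ipderiv α (fun y => a y j * pderiv j (w i) y) x - a x j * ipderiv α (pderiv j (w i)) x| ≤
        2 ^ n * ∑ k ∈ Finset.Icc 1 n, (dnorm k (w j) x + dnorm k (fun y => b y j) x) *
          dnorm (n - k + 1) (w i) x := by
      refine hcomm.trans (mul_le_mul_of_nonneg_left (Finset.sum_le_sum fun k _ => ?_) (by positivity))
      exact mul_le_mul (hsplit k) (dnorm_pderiv_le (hw i) _ j x) (dnorm_nonneg _ _ _)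
        (add_nonneg (dnorm_nonneg _ _ _) (dnorm_nonneg _ _ _))
    calc χ x * (|ipderiv α (fun y => a y j * pderiv j (w i) y) x - a x j * ipderiv α (pderiv j (w i)) x| *
          |ipderiv α (w i) x|)
        ≤ χ x * ((2 ^ n * ∑ k ∈ Finset.Icc 1 n, (dnorm k (w j) x + dnorm k (fun y => b y j) x) *
            dnorm (n - k + 1) (w i) x) * |ipderiv α (w i) x|) :=
          mul_le_mul_of_nonneg_left (mul_le_mul_of_nonneg_right h2 (abs_nonneg _)) (hχ0 x)
      _ = _ := by
          rw [mul_assoc, Finset.sum_mul, Finset.mul_sum, Finset.mul_sum]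
          exact Finset.sum_congr rfl fun k _ => by ring
  -- the `b`-pieces
  have hP : ∀ i j, ∀ k ∈ Finset.Icc 1 n,
      Integrable (fun x => 2 ^ n * (χ x * (dnorm k (fun y => b y j) x * (dnorm (n - k + 1) (w i) x *
        |ipderiv α (w i) x|)))) (volume : Measure (EuclideanSpace ℝ ι)) ∧
      ∫ x, 2 ^ n * (χ x * (dnorm k (fun y => b y j) x * (dnorm (n - k + 1) (w i) x * |ipderiv α (w i) x|))) ≤
        2 ^ n * Bb * (Real.sqrt (L (n - k + 1)) * Real.sqrt (L n)) := by
    intro i j k hk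
    have hk' : 1 ≤ k ∧ k ≤ n := Finset.mem_Icc.1 hk
    obtain ⟨mw, lew⟩ := constantin_memLp_dnorm_and_le hw (n - k + 1) (hI (n - k + 1) (by omega)) i
    obtain ⟨mG, leG⟩ := constantin_memLp_ipderiv_and_le hw (hI n le_rfl) α i
    have hb' : ∀ x, |dnorm k (fun y => b y j) x| ≤ Bb := fun x => by
      rw [abs_of_nonneg (dnorm_nonneg _ _ _)]; exact hBb k (by omega) j x
    have hle : ∀ x, |2 ^ n * (χ x * (dnorm k (fun y => b y j) x * (dnorm (n - k + 1) (w i) x *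
        |ipderiv α (w i) x|)))| ≤
        2 ^ n * (|dnorm k (fun y => b y j) x| * (|dnorm (n - k + 1) (w i) x| * |ipderiv α (w i) x|)) := by
      intro x
      rw [abs_mul, abs_mul, abs_mul, abs_mul, abs_abs, abs_of_nonneg (by positivity : (0 : ℝ) ≤ 2 ^ n),
        abs_of_nonneg (hχ0 x)]
      refine mul_le_mul_of_nonneg_left ?_ (by positivity)
      exact mul_le_of_le_one_left (by positivity) (hχ1 x)
    refine ⟨?_, ?_⟩
    · have hc : Continuous fun x => 2 ^ n * (χ x * (dnorm k (fun y => b y j) x * (dnorm (n - k + 1) (w i) x *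
          |ipderiv α (w i) x|))) :=
        continuous_const.mul (hχcont.mul ((continuous_dnorm (hB j) k).mul
          ((continuous_dnorm (hw i) _).mul (hG i).continuous.abs)))
      refine integrable_of_abs_le_mul hc.aestronglyMeasurable mw mG (C := 2 ^ n * Bb) fun x => (hle x).trans ?_
      calc 2 ^ n * (|dnorm k (fun y => b y j) x| * (|dnorm (n - k + 1) (w i) x| * |ipderiv α (w i) x|))
          ≤ 2 ^ n * (Bb * (|dnorm (n - k + 1) (w i) x| * |ipderiv α (w i) x|)) :=
            mul_le_mul_of_nonneg_left (mul_le_mul_of_nonneg_right (hb' x) (by positivity)) (by positivity)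
        _ = 2 ^ n * Bb * (|dnorm (n - k + 1) (w i) x| * |ipderiv α (w i) x|) := by ring
    · refine (integral_le_of_abs_le_mul_mul mw mG (by positivity) hBb0 hb' hle).trans ?_
      exact mul_le_mul_of_nonneg_left (mul_le_mul lew leG (Real.sqrt_nonneg _) (Real.sqrt_nonneg _))
        (by positivity)
  -- the trilinear pieces are integrable (compactly supported weight)
  have hQ : ∀ i j k, Integrable (fun x => 2 ^ n * (χ x * (dnorm k (w j) x * (dnorm (n - k + 1) (w i) x *
      |ipderiv α (w i) x|)))) (volume : Measure (EuclideanSpace ℝ ι)) := fun i j k =>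
    (constantin_integrable_weight_mul hχcont hχc ((continuous_dnorm (hw j) k).mul
      ((continuous_dnorm (hw i) _).mul (hG i).continuous.abs))).const_mul _
  -- integrate the pointwise bound for each `(i, j)`
  have hij : ∀ i j, -∫ x, χ x * ((ipderiv α (fun y => a y j * pderiv j (w i) y) x -
      a x j * ipderiv α (pderiv j (w i)) x) * ipderiv α (w i) x) ≤
      (∑ k ∈ Finset.Icc 1 n, 2 ^ n * Bb * (Real.sqrt (L (n - k + 1)) * Real.sqrt (L n))) +
        ∑ k ∈ Finset.Icc 1 n, 2 ^ n *
          ∫ x, χ x * (dnorm k (w j) x * (dnorm (n - k + 1) (w i) x * |ipderiv α (w i) x|)) := by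
    intro i j
    rw [← integral_neg]
    have hcomm : Continuous fun x => ipderiv α (fun y => a y j * pderiv j (w i) y) x -
        a x j * ipderiv α (pderiv j (w i)) x := by
      have h1 : Continuous (ipderiv α fun y => a y j * pderiv j (w i) y) :=
        (contDiff_ipderiv ((hA j).mul (contDiff_pderiv (hw i) j)) α).continuous
      have h2 : Continuous (ipderiv α (pderiv j (w i))) := (contDiff_ipderiv (contDiff_pderiv (hw i) j) α).continuous
      have h3 : Continuous fun x => a x j := (hA j).continuous
      fun_prop
    have hint1 : Integrable (fun x => -(χ x * ((ipderiv α (fun y => a y j * pderiv j (w i) y) x -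
        a x j * ipderiv α (pderiv j (w i)) x) * ipderiv α (w i) x))) (volume : Measure (EuclideanSpace ℝ ι)) :=
      (constantin_integrable_weight_mul hχcont hχc (hcomm.mul (hG i).continuous)).neg
    have hint2 : Integrable (fun x => ∑ k ∈ Finset.Icc 1 n,
        (2 ^ n * (χ x * (dnorm k (fun y => b y j) x * (dnorm (n - k + 1) (w i) x * |ipderiv α (w i) x|))) +
          2 ^ n * (χ x * (dnorm k (w j) x * (dnorm (n - k + 1) (w i) x * |ipderiv α (w i) x|)))))
        (volume : Measure (EuclideanSpace ℝ ι)) :=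
      integrable_finsetSum _ fun k hk => (hP i j k hk).1.add (hQ i j k)
    refine (integral_mono hint1 hint2 fun x => hpt i j x).trans ?_
    rw [integral_finsetSum _ (f := fun k x =>
        (2 ^ n * (χ x * (dnorm k (fun y => b y j) x * (dnorm (n - k + 1) (w i) x * |ipderiv α (w i) x|))) +
          2 ^ n * (χ x * (dnorm k (w j) x * (dnorm (n - k + 1) (w i) x * |ipderiv α (w i) x|)))))
        fun k hk => (hP i j k hk).1.add (hQ i j k), ← Finset.sum_add_distrib]
    refine Finset.sum_le_sum fun k hk => ?_
    simp only
    rw [integral_add (hP i j k hk).1 (hQ i j k), integral_const_mul, integral_const_mul]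
    have h := (hP i j k hk).2
    rw [integral_const_mul] at h
    exact add_le_add h le_rfl
  -- linearity in `i` and summation
  have hlin : ∀ i, ∫ x, χ x * ((∑ j, (ipderiv α (fun y => a y j * pderiv j (w i) y) x -
      a x j * ipderiv α (pderiv j (w i)) x)) * ipderiv α (w i) x) =
      ∑ j, ∫ x, χ x * ((ipderiv α (fun y => a y j * pderiv j (w i) y) x -
        a x j * ipderiv α (pderiv j (w i)) x) * ipderiv α (w i) x) := by
    intro i
    rw [← integral_finsetSum _ fun j _ => ?_]
    · refine integral_congr_ae (Eventually.of_forall fun x => ?_)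
      simp only [Finset.sum_mul, Finset.mul_sum]
    · have h1 : Continuous (ipderiv α fun y => a y j * pderiv j (w i) y) :=
        (contDiff_ipderiv ((hA j).mul (contDiff_pderiv (hw i) j)) α).continuous
      have h2 : Continuous (ipderiv α (pderiv j (w i))) := (contDiff_ipderiv (contDiff_pderiv (hw i) j) α).continuous
      have h3 : Continuous fun x => a x j := (hA j).continuous
      have h4 : Continuous (ipderiv α (w i)) := (hG i).continuous
      exact constantin_integrable_weight_mul hχcont hχc (by fun_prop)
  simp only [hlin]
  rw [← Finset.sum_neg_distrib]
  simp only [← Finset.sum_neg_distrib]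
  calc ∑ i, ∑ j, -∫ x, χ x * ((ipderiv α (fun y => a y j * pderiv j (w i) y) x -
        a x j * ipderiv α (pderiv j (w i)) x) * ipderiv α (w i) x)
      ≤ ∑ i, ∑ j, ((∑ k ∈ Finset.Icc 1 n, 2 ^ n * Bb * (Real.sqrt (L (n - k + 1)) * Real.sqrt (L n))) +
          ∑ k ∈ Finset.Icc 1 n, 2 ^ n *
            ∫ x, χ x * (dnorm k (w j) x * (dnorm (n - k + 1) (w i) x * |ipderiv α (w i) x|))) :=
        Finset.sum_le_sum fun i _ => Finset.sum_le_sum fun j _ => hij i j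
    _ = _ := by
        rw [Finset.sum_comm]
        simp only [Finset.sum_add_distrib, Finset.sum_const, Finset.card_univ, nsmul_eq_mul, ← Finset.mul_sum,
          ← Finset.sum_mul]
        rw [Finset.sum_comm]
        ring

/-- **The pressure term is a cutoff error.** With `Gᵢ = ∂^α wᵢ`, `div w = 0`, the pressure
difference `p₁ − p₂ = Q + c₀` with `Q ∈ L²` (the difference of the normalised pressures) and
`|∇ᵏχ| ≤ A/R` for `1 ≤ k ≤ n + 1`:
`−∑ᵢ ∫ χ (∂ᵢ∂^α(p₁ − p₂)) Gᵢ ≤ (A/R) 2ⁿ ‖Q‖₂ ‖Z‖₂`, `Z = ∑ᵢ ∑_{k≤n} |∇^{n-k} Gᵢ|`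
(`constantin_pressure_pairing_eq`, the constant `c₀` integrates to zero against the test function,
Cauchy–Schwarz; Constantin 1986, (1.9): `(∇r, w)_m = 0`). [cite: Constantin1986, §1 (1.9)] -/
theorem constantin_pressure_term_le {w : ι → EuclideanSpace ℝ ι → ℝ} {p₁ p₂ Q χ : EuclideanSpace ℝ ι → ℝ} {c₀ : ℝ}
    (hw : ∀ i, ContDiff ℝ ∞ (w i)) (hdiv : ∀ x, ∑ i, pderiv i (w i) x = 0)
    (hp₁ : ContDiff ℝ ∞ p₁) (hp₂ : ContDiff ℝ ∞ p₂) (hrQ : ∀ x, p₁ x - p₂ x = Q x + c₀)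
    (hQ : MemLp Q 2 (volume : Measure (EuclideanSpace ℝ ι)))
    (hχ : ContDiff ℝ ∞ χ) (hχc : HasCompactSupport χ) {n : ℕ} (α : Fin n → ι)
    (hI : ∀ k, k ≤ 2 * n → Integrable (fun x => ∑ i, dnormSq k (w i) x) (volume : Measure (EuclideanSpace ℝ ι)))
    {AR : ℝ} (hAR0 : 0 ≤ AR) (hAR : ∀ k, 1 ≤ k → k ≤ n + 1 → ∀ x, dnorm k χ x ≤ AR) :
    -∑ i, ∫ x, χ x * (pderiv i (ipderiv α fun z => p₁ z - p₂ z) x * ipderiv α (w i) x) ≤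
      AR * 2 ^ n * (Real.sqrt (∫ x, Q x ^ 2) *
        Real.sqrt (∫ x, (∑ i, ∑ k ∈ Finset.range (n + 1), dnorm (n - k) (ipderiv α (w i)) x) ^ 2)) := by
  have hG : ∀ i, ContDiff ℝ ∞ (ipderiv α (w i)) := fun i => contDiff_ipderiv (hw i) α
  have hr : ContDiff ℝ ∞ fun z => p₁ z - p₂ z := hp₁.sub hp₂
  set Ψ : EuclideanSpace ℝ ι → ℝ :=
    ipderiv α (fun y => ∑ i, pderiv i χ y * ipderiv α (w i) y) with hΨ
  set Z : EuclideanSpace ℝ ι → ℝ :=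
    fun x => ∑ i, ∑ k ∈ Finset.range (n + 1), dnorm (n - k) (ipderiv α (w i)) x with hZ
  -- the identity
  have hid : -∑ i, ∫ x, χ x * (pderiv i (ipderiv α fun z => p₁ z - p₂ z) x * ipderiv α (w i) x) =
      (-1) ^ n * ∫ x, (p₁ x - p₂ x) * Ψ x := by
    rw [constantin_pressure_pairing_eq hw hdiv hr hχ hχc α, neg_neg]
  -- `Ψ` is smooth with compact support, hence in `L²`
  have hΦsmooth : ContDiff ℝ ∞ fun y => ∑ i, pderiv i χ y * ipderiv α (w i) y :=
    ContDiff.sum fun i _ => (contDiff_pderiv hχ i).mul (hG i)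
  have hΦc : HasCompactSupport fun y => ∑ i, pderiv i χ y * ipderiv α (w i) y := by
    refine hχc.fderiv (𝕜 := ℝ) |>.mono ?_
    intro y hy
    rw [Function.mem_support] at hy ⊢
    contrapose! hy
    have : ∀ i, pderiv i χ y = 0 := fun i => by rw [pderiv_apply, hy]; rfl
    simp [this]
  have hΨsmooth : ContDiff ℝ ∞ Ψ := contDiff_ipderiv hΦsmooth α
  have hΨc : HasCompactSupport Ψ := ipderiv_hasCompactSupport hΦc α
  have hΨmem : MemLp Ψ 2 (volume : Measure (EuclideanSpace ℝ ι)) :=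
    hΨsmooth.continuous.memLp_of_hasCompactSupport hΨc
  -- remove the constant: `∫ (p₁ - p₂) Ψ = ∫ Q Ψ`
  have hQΨ : Integrable (fun x => Q x * Ψ x) (volume : Measure (EuclideanSpace ℝ ι)) := hQ.integrable_mul hΨmem
  have hcΨ : Integrable (fun x => c₀ * Ψ x) (volume : Measure (EuclideanSpace ℝ ι)) :=
    (hΨsmooth.continuous.integrable_of_hasCompactSupport hΨc).const_mul c₀
  have hconst : ∫ x, (p₁ x - p₂ x) * Ψ x = ∫ x, Q x * Ψ x := by
    have e : ∀ x, (p₁ x - p₂ x) * Ψ x = Q x * Ψ x + c₀ * Ψ x := fun x => by rw [hrQ x]; ring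
    simp only [e]
    rw [integral_add hQΨ hcΨ, integral_const_mul, hΨ,
      constantin_integral_ipderiv_pressureTest_eq_zero hw hdiv hχ hχc α, mul_zero, add_zero]
  -- pointwise bound of `Ψ`
  have hΨle : ∀ x, |Ψ x| ≤ 2 ^ n * AR * Z x := by
    intro x
    refine (constantin_abs_ipderiv_pressureTest_le hw hχ α x).trans ?_
    rw [hZ]
    simp only [mul_assoc, Finset.mul_sum]
    refine Finset.sum_le_sum fun i _ => Finset.sum_le_sum fun k hk => ?_
    have hkn : k ≤ n := Nat.lt_succ_iff.1 (Finset.mem_range.1 hk)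
    refine mul_le_mul_of_nonneg_left ?_ (by positivity)
    exact mul_le_mul_of_nonneg_right (hAR (k + 1) (by omega) (by omega) x) (dnorm_nonneg _ _ _)
  -- `Z ∈ L²`
  have hZmem : MemLp Z 2 (volume : Measure (EuclideanSpace ℝ ι)) := by
    rw [hZ]
    refine memLp_finsetSum _ fun i _ => memLp_finsetSum _ fun k hk => ?_
    have hkn : k ≤ n := Nat.lt_succ_iff.1 (Finset.mem_range.1 hk)
    have hIi : Integrable (dnormSq (n - k + n) (w i)) :=
      (constantin_integrable_dnormSq_of_sum hw (n - k + n) (hI (n - k + n) (by omega)) i).1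
    exact (memLp_dnorm_of_integrable_dnormSq (hG i) (n - k)
      (integrable_dnormSq_ipderiv (hw i) (n - k) α hIi)).1
  have hZ0 : ∀ x, 0 ≤ Z x := fun x =>
    Finset.sum_nonneg fun i _ => Finset.sum_nonneg fun k _ => dnorm_nonneg _ _ _
  -- Cauchy–Schwarz
  rw [hid, hconst, ← integral_const_mul]
  have h2n : (0 : ℝ) ≤ 2 ^ n := by positivity
  refine (integral_le_of_abs_le_mul hQ hZmem (mul_nonneg hAR0 h2n) fun x => ?_).trans (le_of_eq (by ring))
  rw [abs_mul, abs_mul, abs_pow, abs_neg, abs_one, one_pow, one_mul, abs_of_nonneg (hZ0 x)]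
  calc |Q x| * |Ψ x| ≤ |Q x| * (2 ^ n * AR * Z x) := mul_le_mul_of_nonneg_left (hΨle x) (abs_nonneg _)
    _ = AR * 2 ^ n * (|Q x| * Z x) := by ring

end Bounds

/-! ## The slice inequality for a fixed word -/

section Slice

variable {ι : Type*} [Fintype ι] [DecidableEq ι]

/-- **The slice inequality for a fixed word `α`, `|α| = n`** (Constantin 1986, the `H^m` energy
inequality (1.10) before time integration, localised with a weight `0 ≤ χ ≤ 1` of compact
support all of whose derivatives of orders `1, …, n + 1` are bounded by `A_R`, e.g. `χ_R` with
`A_R = A/R`). For smooth divergence-free `a` (Navier–Stokes slice), `b` (Euler slice), pressures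
with `p₁ − p₂ = Q + c₀`, `Q ∈ L²`, and `w = a − b`, `Gᵢ = ∂^α wᵢ`, the pairing of the
`∂^α`-differentiated difference of the right-hand sides with `χ G` is bounded by
cutoff errors `A_R · (…)`, the forcing `ν (card ι)² ‖∇ⁿ⁺²b‖₂‖∇ⁿw‖₂`, the linear terms
`2ⁿ(card ι)²B_b (n+1) (∑_{k≤n}‖∇ᵏw‖₂) ‖∇ⁿw‖₂` and the trilinear terms
`2ⁿ ∑_{i,j,1≤k≤n} ∫ χ|∇ᵏwⱼ||∇^{n-k+1}wᵢ||Gᵢ|`. [cite: Constantin1986, §1 (1.7)-(1.10)] -/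
theorem constantin_slice_word_pairing_le {a b : EuclideanSpace ℝ ι → EuclideanSpace ℝ ι}
    {p₁ p₂ Q χ : EuclideanSpace ℝ ι → ℝ} {c₀ : ℝ}
    (ha : ContDiff ℝ ∞ a) (hb : ContDiff ℝ ∞ b)
    (hdiva : ∀ x, ∑ j, pderiv j (fun y => a y j) x = 0) (hdivb : ∀ x, ∑ j, pderiv j (fun y => b y j) x = 0)
    (hp₁ : ContDiff ℝ ∞ p₁) (hp₂ : ContDiff ℝ ∞ p₂) (hrQ : ∀ x, p₁ x - p₂ x = Q x + c₀)
    (hQ : MemLp Q 2 (volume : Measure (EuclideanSpace ℝ ι)))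
    (hχ : ContDiff ℝ ∞ χ) (hχc : HasCompactSupport χ) (hχ0 : ∀ x, 0 ≤ χ x) (hχ1 : ∀ x, χ x ≤ 1)
    {n : ℕ} (α : Fin n → ι)
    (hI : ∀ k, Integrable (fun x => ∑ i, dnormSq k (fun z => a z i - b z i) x) (volume : Measure (EuclideanSpace ℝ ι)))
    (hIb : Integrable (fun x => ∑ i, dnormSq (n + 2) (fun y => b y i) x) (volume : Measure (EuclideanSpace ℝ ι)))
    {ν Ba Bb AR : ℝ} (hν : 0 ≤ ν) (hBa0 : 0 ≤ Ba) (hBa : ∀ x j, |a x j| ≤ Ba) (hBb0 : 0 ≤ Bb)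
    (hBb : ∀ k, k ≤ n + 1 → ∀ i x, dnorm k (fun y => b y i) x ≤ Bb) (hAR0 : 0 ≤ AR)
    (hAR1 : ∀ j x, |pderiv j χ x| ≤ AR) (hAR : ∀ k, 1 ≤ k → k ≤ n + 1 → ∀ x, dnorm k χ x ≤ AR) :
    ∑ i, ∫ x, χ x *
      ((ipderiv α (fun y => ν * ∑ j, pderiv j (pderiv j fun z => a z i) y - pderiv i p₁ y -
            ∑ j, a y j * pderiv j (fun z => a z i) y) x -
          ipderiv α (fun y => 0 * ∑ j, pderiv j (pderiv j fun z => b z i) y - pderiv i p₂ y -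
            ∑ j, b y j * pderiv j (fun z => b z i) y) x) *
        ipderiv α (fun z => a z i - b z i) x) ≤
      AR * (2⁻¹ * (Fintype.card ι) ^ 2 * Ba * (∫ x, ∑ i, dnormSq n (fun z => a z i - b z i) x) +
          ν * (Fintype.card ι) ^ 2 * Real.sqrt (∫ x, ∑ i, dnormSq n (fun z => a z i - b z i) x) *
            Real.sqrt (∫ x, ∑ i, dnormSq (n + 1) (fun z => a z i - b z i) x) +
          2 ^ n * Real.sqrt (∫ x, Q x ^ 2) *
            Real.sqrt (∫ x, (∑ i, ∑ k ∈ Finset.range (n + 1),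
              dnorm (n - k) (ipderiv α fun z => a z i - b z i) x) ^ 2)) +
      ν * (Fintype.card ι) ^ 2 * Real.sqrt (∫ x, ∑ i, dnormSq (n + 2) (fun y => b y i) x) *
        Real.sqrt (∫ x, ∑ i, dnormSq n (fun z => a z i - b z i) x) +
      2 ^ n * (Fintype.card ι) ^ 2 * Bb * (n + 1) *
        (∑ k ∈ Finset.range (n + 1), Real.sqrt (∫ x, ∑ i, dnormSq k (fun z => a z i - b z i) x)) *
        Real.sqrt (∫ x, ∑ i, dnormSq n (fun z => a z i - b z i) x) +
      2 ^ n * ∑ i, ∑ j, ∑ k ∈ Finset.Icc 1 n,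
        ∫ x, χ x * (dnorm k (fun z => a z j - b z j) x *
          (dnorm (n - k + 1) (fun z => a z i - b z i) x * |ipderiv α (fun z => a z i - b z i) x|)) := by
  -- the component family `w`
  set w : ι → EuclideanSpace ℝ ι → ℝ := fun i z => a z i - b z i with hw_def
  have hA : ∀ j, ContDiff ℝ ∞ fun y => a y j := fun j => contDiff_comp_of_contDiff ha j
  have hB : ∀ j, ContDiff ℝ ∞ fun y => b y j := fun j => contDiff_comp_of_contDiff hb j
  have hw : ∀ i, ContDiff ℝ ∞ (w i) := fun i => (hA i).sub (hB i)
  have hwab : ∀ i y, w i y = a y i - b y i := fun i y => rfl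
  have hdivw : ∀ x, ∑ i, pderiv i (w i) x = 0 := by
    intro x
    have e : ∀ i, pderiv i (w i) x = pderiv i (fun y => a y i) x - pderiv i (fun y => b y i) x := fun i => by
      show pderiv i (fun z => a z i - b z i) x = _
      rw [pderiv_sub ((hA i).differentiable (by simp)) ((hB i).differentiable (by simp))]
    simp only [e, Finset.sum_sub_distrib, hdiva x, hdivb x, sub_zero]
  have hG : ∀ i, ContDiff ℝ ∞ (ipderiv α (w i)) := fun i => contDiff_ipderiv (hw i) α
  have hχcont : Continuous χ := hχ.continuous
  set L : ℕ → ℝ := fun k => ∫ x, ∑ i, dnormSq k (w i) x with hL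
  -- the five integrands, component by component
  set V : ι → EuclideanSpace ℝ ι → ℝ := fun i x =>
    (ν * ∑ j, pderiv j (pderiv j (ipderiv α fun z => a z i)) x) * ipderiv α (w i) x with hV
  set T : ι → EuclideanSpace ℝ ι → ℝ := fun i x =>
    (∑ j, a x j * pderiv j (ipderiv α (w i)) x) * ipderiv α (w i) x with hT
  set C : ι → EuclideanSpace ℝ ι → ℝ := fun i x =>
    (∑ j, (ipderiv α (fun y => a y j * pderiv j (w i) y) x - a x j * ipderiv α (pderiv j (w i)) x)) *
      ipderiv α (w i) x with hC
  set Li : ι → EuclideanSpace ℝ ι → ℝ := fun i x =>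
    (∑ j, ipderiv α (fun y => w j y * pderiv j (fun z => b z i) y) x) * ipderiv α (w i) x with hLi
  set P : ι → EuclideanSpace ℝ ι → ℝ := fun i x =>
    pderiv i (ipderiv α fun z => p₁ z - p₂ z) x * ipderiv α (w i) x with hP
  -- pointwise decomposition
  have hdec : ∀ i x,
      χ x * ((ipderiv α (fun y => ν * ∑ j, pderiv j (pderiv j fun z => a z i) y - pderiv i p₁ y -
            ∑ j, a y j * pderiv j (fun z => a z i) y) x -
          ipderiv α (fun y => 0 * ∑ j, pderiv j (pderiv j fun z => b z i) y - pderiv i p₂ y -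
            ∑ j, b y j * pderiv j (fun z => b z i) y) x) * ipderiv α (fun z => a z i - b z i) x) =
      χ x * V i x - χ x * T i x - χ x * C i x - χ x * Li i x - χ x * P i x := by
    intro i x
    rw [constantin_ipderiv_rhs_sub_rhs_eq ha hb hp₁ hp₂ ν α i x]
    simp only [hV, hT, hC, hLi, hP, hw_def]
    ring
  -- integrability of the five pieces
  have hcA : ∀ i, Continuous (ipderiv α (w i)) := fun i => (hG i).continuous
  have iV : ∀ i, Integrable (fun x => χ x * V i x) (volume : Measure (EuclideanSpace ℝ ι)) := fun i => by
    refine constantin_integrable_weight_mul hχcont hχc ?_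
    have h1 : ∀ j, Continuous (pderiv j (pderiv j (ipderiv α fun z => a z i))) := fun j =>
      (contDiff_pderiv (contDiff_pderiv (contDiff_ipderiv (hA i) α) j) j).continuous
    have h2 := hcA i
    simp only [hV]
    fun_prop
  have iT : ∀ i, Integrable (fun x => χ x * T i x) (volume : Measure (EuclideanSpace ℝ ι)) := fun i => by
    refine constantin_integrable_weight_mul hχcont hχc ?_
    have h1 : ∀ j, Continuous (pderiv j (ipderiv α (w i))) := fun j => (contDiff_pderiv (hG i) j).continuous
    have h2 := hcA i
    have h3 : Continuous a := ha.continuous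
    simp only [hT]
    fun_prop
  have iC : ∀ i, Integrable (fun x => χ x * C i x) (volume : Measure (EuclideanSpace ℝ ι)) := fun i => by
    refine constantin_integrable_weight_mul hχcont hχc ?_
    have h1 : ∀ j, Continuous (ipderiv α fun y => a y j * pderiv j (w i) y) := fun j =>
      (contDiff_ipderiv ((hA j).mul (contDiff_pderiv (hw i) j)) α).continuous
    have h2 : ∀ j, Continuous (ipderiv α (pderiv j (w i))) := fun j =>
      (contDiff_ipderiv (contDiff_pderiv (hw i) j) α).continuous
    have h3 : Continuous a := ha.continuous
    have h4 := hcA i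
    simp only [hC]
    fun_prop
  have iLi : ∀ i, Integrable (fun x => χ x * Li i x) (volume : Measure (EuclideanSpace ℝ ι)) := fun i => by
    refine constantin_integrable_weight_mul hχcont hχc ?_
    have h1 : ∀ j, Continuous (ipderiv α fun y => w j y * pderiv j (fun z => b z i) y) := fun j =>
      (contDiff_ipderiv ((hw j).mul (contDiff_pderiv (hB i) j)) α).continuous
    have h4 := hcA i
    simp only [hLi]
    fun_prop
  have iP : ∀ i, Integrable (fun x => χ x * P i x) (volume : Measure (EuclideanSpace ℝ ι)) := fun i => by
    refine constantin_integrable_weight_mul hχcont hχc ?_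
    have h1 : Continuous (pderiv i (ipderiv α fun z => p₁ z - p₂ z)) :=
      (contDiff_pderiv (contDiff_ipderiv (hp₁.sub hp₂) α) i).continuous
    have h4 := hcA i
    simp only [hP]
    fun_prop
  -- split the integrals and the sum over `i`
  have hsplit : ∑ i, ∫ x, χ x *
      ((ipderiv α (fun y => ν * ∑ j, pderiv j (pderiv j fun z => a z i) y - pderiv i p₁ y -
            ∑ j, a y j * pderiv j (fun z => a z i) y) x -
          ipderiv α (fun y => 0 * ∑ j, pderiv j (pderiv j fun z => b z i) y - pderiv i p₂ y -
            ∑ j, b y j * pderiv j (fun z => b z i) y) x) * ipderiv α (fun z => a z i - b z i) x) =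
      (∑ i, ∫ x, χ x * V i x) + (-∑ i, ∫ x, χ x * T i x) + (-∑ i, ∫ x, χ x * C i x) +
        (-∑ i, ∫ x, χ x * Li i x) + (-∑ i, ∫ x, χ x * P i x) := by
    have e : ∀ i, ∫ x, χ x *
        ((ipderiv α (fun y => ν * ∑ j, pderiv j (pderiv j fun z => a z i) y - pderiv i p₁ y -
            ∑ j, a y j * pderiv j (fun z => a z i) y) x -
          ipderiv α (fun y => 0 * ∑ j, pderiv j (pderiv j fun z => b z i) y - pderiv i p₂ y -
            ∑ j, b y j * pderiv j (fun z => b z i) y) x) * ipderiv α (fun z => a z i - b z i) x) =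
        (∫ x, χ x * V i x) - (∫ x, χ x * T i x) - (∫ x, χ x * C i x) - (∫ x, χ x * Li i x) -
          ∫ x, χ x * P i x := by
      intro i
      rw [integral_congr_ae (Eventually.of_forall (hdec i)), integral_sub, integral_sub, integral_sub,
        integral_sub (iV i) (iT i)]
      · exact (iV i).sub (iT i)
      · exact iC i
      · exact ((iV i).sub (iT i)).sub (iC i)
      · exact iLi i
      · exact (((iV i).sub (iT i)).sub (iC i)).sub (iLi i)
      · exact iP i
    simp only [e, Finset.sum_sub_distrib]
    ring
  rw [hsplit]
  -- the five bounds
  have bT := constantin_transport_term_le ha hdiva hw hχ hχc α (hI n) hBa0 hBa hAR0 hAR1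
  have bV := constantin_viscous_term_le ha hb hw hwab hχ hχc hχ0 hχ1 α (hI n) (hI (n + 1)) hIb hν hAR0 hAR1
  have bL := constantin_linear_term_le hb hw hχ hχc hχ0 hχ1 α (fun k _ => hI k) hBb0 hBb
  have bC := constantin_commutator_term_le ha hb hw hwab hχ hχc hχ0 hχ1 α (fun k _ => hI k) hBb0 hBb
  have bP := constantin_pressure_term_le hw hdivw hp₁ hp₂ hrQ hQ hχ hχc α (fun k _ => hI k) hAR0 hAR
  simp only [hV, hT, hC, hLi, hP] at bT bV bL bC bP ⊢
  -- the commutator's `b`-part: `∑_{1≤k≤n} √L(n-k+1) ≤ n · ∑_{k≤n} √L(k)`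
  set S : ℝ := ∑ k ∈ Finset.range (n + 1), Real.sqrt (L k) with hS
  have hS0 : 0 ≤ S := Finset.sum_nonneg fun k _ => Real.sqrt_nonneg _
  have hreindex : ∑ k ∈ Finset.Icc 1 n, Real.sqrt (L (n - k + 1)) ≤ n * S := by
    calc ∑ k ∈ Finset.Icc 1 n, Real.sqrt (L (n - k + 1)) ≤ ∑ _k ∈ Finset.Icc 1 n, S := by
          refine Finset.sum_le_sum fun k hk => ?_
          have hk' := Finset.mem_Icc.1 hk
          exact Finset.single_le_sum (f := fun k => Real.sqrt (L k)) (fun _ _ => Real.sqrt_nonneg _)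
            (Finset.mem_range.2 (by omega))
      _ = n * S := by rw [Finset.sum_const, Nat.card_Icc, nsmul_eq_mul]; push_cast; ring_nf
  have hLn0 : 0 ≤ Real.sqrt (L n) := Real.sqrt_nonneg _
  have hcomm_b : 2 ^ n * (Fintype.card ι : ℝ) ^ 2 * Bb *
      (∑ k ∈ Finset.Icc 1 n, Real.sqrt (L (n - k + 1))) * Real.sqrt (L n) ≤
      2 ^ n * (Fintype.card ι : ℝ) ^ 2 * Bb * (n * S) * Real.sqrt (L n) := by
    gcongr
  -- assemble
  simp only [hL, hw_def] at hcomm_b hreindex hS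
  nlinarith [bT, bV, bL, bC, bP, hcomm_b, hS0, hLn0, hBb0, hAR0, hν]

end Slice

end Literature.Analysis.FluidPDE

end
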